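import Literature.AlgebraicGeometry.HodgeTheory.RankOneCentreTimesSimpleCMSurfaceProductSpan
import Literature.AlgebraicGeometry.HodgeTheory.QuarticCMTwoOnePowersHodgeClasses
import Literature.AlgebraicGeometry.HodgeTheory.QuarticCMHodgeGroupPowersHodgeClasses
import Literature.AlgebraicGeometry.HodgeTheory.CMHodgeGroupCentreWeil
import Literature.AlgebraicGeometry.Motives.HodgeThetaAnnihilatorQuarticCentreTimesTorus
import Literature.NumberTheory.ComplexMultiplication.QuarticCMTraceFieldPresentation
import HarnessLib

/-!
# `Y × S`, `Y` a simple abelian fourfold with QUARTIC CM CENTRE `E = End⁰(Y)` of signature `{(2,0),(1,1)}`, `S` a simple CM abelian surface of type `(F, Φ)`: `Hg(Y × S) = Hg(Y) × Hg(S)` and `B•((Y × S)ⁿ) = D•` whenever `τ₀(E) = ℚ(μ₂)` and the reflex field `K*_Φ` share no purely imaginary element — the NON-ALIGNED configurations (TABLE X row 25; Moonen–Zarhin 1999 §3 (3.1), Lemma (3.6), §5 Case 2)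

Family `hodge`, layer `Literature/AlgebraicGeometry/HodgeTheory`. Research context: cell `pub-hodgeav-hg6` (LADDER-HodgeAV
PERC-SHAPE row 2 «base of HC ladder», req-37 (A) Q2b, TABLE X row 25 `g6.S_ErxY4_E.D4.other ∕ .samefield`; plan of record
`run/shared/lean/pub/pub-hodgeav-hg6/jobs/ROW25-eng2g7/MEMO.md`, brick R25-2; HONEST FRAMING: nothing here proves HC for
the ALIGNED members — the K3 partners of TABLE X rows 23 ∕ 24, residue R-K3P, OPEN —, nor `HC_AV`, nor `HC_CM`; not a
corollary). UNCONDITIONAL for the class of pairs it names (no HC_CM); theorems only (no definition, no named fact, D-0026;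
nothing admitted). The sibling of `RankOneCentreTimesSimpleCMSurfaceProductSpan` (R28b: centre of rank ONE against the
`ℚ`-simple torus `U_F`, row (5.10) `S × T`) for a centre of rank TWO, with the Lie step
`Motives/HodgeThetaAnnihilatorQuarticCentreTimesTorus` (trace non-alignment (NA)).

PRINTED RESULTS. B. Moonen, Yu. Zarhin, *Hodge classes on abelian varieties of low dimension*, Math. Ann. 315 (1999)
[held `paper:arxiv-math_9901113`]: §3 (3.1) (chunk p0006) «`Hg(X)` is an algebraic subgroup of `Hg(X_1) × Hg(X_2)` […]
`𝔤₃` is the graph of an isomorphism […] We may have that `Hg(X_1 × X_2) ≠ Hg(X_1) × Hg(X_2)`»; Lemma (3.6) (chunk p0007)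
«If `Hg(X) ≠ Hg(X₁) × Hg(X₂)` then the center of `Hg(X₁)` contains an algebraic torus which is `ℚ`-isogenous to
`Hg(X₂)`»; Thm. (3.2) (condition (D)); §5 Case 2 (chunk p0010: products with a simple CM surface `Y₁`, `Hg(Y₁) = U_{F₁}`).
For a simple fourfold `Y` with `End⁰(Y) = E` a quartic CM field acting with multiplicities `{(2,0),(1,1)}` the CENTRE of
`Hg(Y) = U_E` is the rank-two torus `U_E¹`, so a simple CM surface CAN interact (the K3 partners: cell record
`Summit.HodgeConjecture.HodgeConjecture.Ring2.Atlas.HodgeQuarticTypeIVFourfoldTimesCMSurface`, negative control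
`QuarticTypeIVFourfoldCMSurfaceSpanFailure`); the interaction test is the ALIGNMENT of the joint Hodge cocharacter, read
here through traces (see the Lie step's docstring): with `τ₀ = (φ ↦ μ₂) : E → ℂ` the embedding at which `Y` has signature
`(2,0)` and `K*_Φ = ℚ(tr_Φ F) ⊂ ℂ` the complex reflex field of `(F, Φ)` (`ComplexReflexField.traceField`), the
NON-ALIGNMENT hypothesis of this file is
  **(hNA) no non-zero purely imaginary complex number lies in both `ℚ(μ₂)` and `K*_Φ`.**
It holds for the members of TABLE X row 25 (`E` non-Galois: `F ≅ E` any `Φ` — `K*_Φ ≅ E^r` does not contain `τ₀(E)`;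
`F ≅ E^r` with `K*_Φ = τ₁(E) ≠ τ₀(E)`), and FAILS for the aligned K3 partners (`K*_Φ = τ₀(E)`) — consistent with the cell's
engines (J4: 16∕16 and 8∕16 placements; J3 ∕ J6 control rows `b = d`). HC for row 25 is NOT claimed beyond these members.

THIS FILE. §0 two tools: `exists_trace_representative_of_skew` (every rational functional is represented on a space of
`ψ`-skew Hodge endomorphisms by `Tr(a ·)` — definiteness of the Rosati trace form, `Polarization.trace_mul_adjoint_self_pos`)
and a private diagonal-trace helper. §1 **`AVSlots.exists_coeff_eq_zero_off_balanced_of_prod_quarticCentre_simpleCMSurface`**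
— the INVARIANCE THEOREM for slots over `Y × S`: R28b's §1 verbatim (Hodge-adapted pair basis of `H¹(Y) ⊗ ℂ`, the
`F`-EIGENBASIS of `H¹(S) ⊗ ℂ`, the compatible polarization `Q^F`, (COMM) `EndAction.mem_spanC_map_of_commute_of_skew`) with
the Lie step `wordDerAt_incl_theta_proj_eq_zero_of_centre_times_torus_of_traceNonAligned`, whose hypotheses are supplied by:
the quartic CM datum of `Y` (`exists_eq_sum_smul_pow_bettiMapHom`: `End_Hdg(H¹Y) = ℚ[φ^*]`; the eigenspace dictionary
`finrank_eigenspace_inf_piece_…_eq_eigenMultiplicity…`; the multiplicity of `μ̄₂` on `H^{1,0}` is `0` by counting), (Z1) with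
`𝔷₁ = {ψ-skew Hodge endomorphisms}`, (ND₁)∕(ND₂) by §0, and **(NA) discharged**: for `a ∈ 𝔷₁` acting by `P_a(c)` on `W_c`,
`Tr(a_ℂ Θ_Y) = 2 Σ_k P_a(μ_k)(p_k − q_k) = 4 P_a(μ₂)` (`CMThetaCentre.trace_baseChange_mul_theta`, signature `(1,1)` at `μ₁`,
`(2,0)` at `μ₂`), `Tr((z^*)_ℂ Θ_S) = Σ_σ ±σ(z) = 2(x z + y z) = 2 tr_Φ(z)` for `z ∈ F⁻` (`Φ = {x, y}`); so the premise reads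
`P_a(μ₂) = −tr_Φ(z)∕2 ∈ ℚ(μ₂) ∩ K*_Φ`, purely imaginary (`σ̄(z) = −σ(z)`), hence `0` by (hNA); then `tr_Φ(z) = 0 ⟹ z = 0`
(`QuarticCM.ratCast_mul_apply_add_ne_zero_of_skew`, (NOSQ) from simplicity `mul_self_ne_algebraMap_of_isSimple_of_isCMTypeRealisation`)
and `P_a(μ₂) = 0 ⟹ a = 0` (`a ≠ 0` is invertible, `exists_mul_eq_one_of_mem_endAlg_of_isSimple`, but kills `W_{μ₂} ≠ 0`).
§2 the PRODUCT SPAN `HodgeClassesProductSpan B Z` for slots over `Y × S` and its equal-powers form (R28b §2 verbatim).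
§3 CONDITION (D): `Y` is stably nondegenerate (R10 `AbelianVariety.isDivisorGenerated_powSucc_of_quarticCM`, every power,
unconditional), a simple surface is (D), hence `Y × S` and `S × Y` are stably nondegenerate
(`isStablyNondegenerate_prod_of_forall_productSpan_powSucc`): **`B•((Y × S)ⁿ) = D•` and the Hodge conjecture for every power
and for everything isogenous to a power of `Y × S` — UNCONDITIONALLY, for every NON-ALIGNED pair.**

SCOPE. `Y`: simple, `dim 4`, `finrank_ℚ End⁰ = 4`, `φ` with eigenvalues on `H^{1,0}` of multiplicities `μ₁ ↦ 1`, `μ̄₁ ↦ 1`,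
`μ₂ ↦ 2` (`μ₁, μ̄₁, μ₂, μ̄₂` pairwise distinct) — exactly R10's class; `S`: a realisation `IsCMTypeRealisation Φ S ι θ` of a CM type of a
quartic CM field, simple. NOT covered: the aligned pairs (rows 23∕24); non-simple CM surfaces (`CentreTimesCMCurveNoEmbedding` ∕
`QuarticCMTimesCMCurveProductSpan`); the field-theoretic discharge of (hNA) from `F ≅ E` (brick R25-3). No Galois ∕ algebraic group.

## References

* [MoonenZarhin1999LowDim] B. Moonen, Yu. Zarhin, Math. Ann. 315 (1999), §3 (3.1), Thm. (3.2), Lemma (3.6), §5 Case 2. [cite: MoonenZarhin1999LowDim, §3 (3.1) and Lemma (3.6)]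
* [Deligne1982HodgeCycles] P. Deligne, LNM 900 (1982), I §3 Prop. 3.4, Prop. 3.6, §4. [cite: Deligne1982HodgeCycles, I §3 Prop. 3.6]
* [Lombardo2016] D. Lombardo, Ann. Inst. Fourier 66 (2016), Lemma 3.4 (p. 1229). [cite: Lombardo2016, Lemma 3.4 (p. 1229)]
* [Shimura1998] G. Shimura, *Abelian Varieties with Complex Multiplication and Modular Functions* (1998), §8.3 Prop. 28. [cite: Shimura1998, §8.3 Prop. 28]
* [Gordon1999HodgeAVSurvey] B. B. Gordon, App. B in Lewis' *Survey* (1999), Thm. 7.5, Def. 7.6. [cite: Gordon1999HodgeAVSurvey, Thm. 7.5 and Def. 7.6]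
* [vanGeemen1994HodgeAV] B. van Geemen, LNM 1594 (1994), §2.4, Lemma 3.7. [cite: vanGeemen1994HodgeAV, Lemma 3.7]
* [MumfordAV1970] D. Mumford, *Abelian Varieties*, §19 Cor. 2, §21. [cite: MumfordAV1970, §21]
-/

noncomputable section

open scoped TensorProduct
open CategoryTheory Module NumberField

namespace Literature.AlgebraicGeometry.HodgeTheory

open Literature.AlgebraicTopology.SingularHomology
open Literature.AlgebraicGeometry.Motives (IsSmoothProjective AbelianVariety bettiCohomology CMType
  ofRatClassBaseChange ofRatClassBaseChange_tmul HodgeTensorFacts hodgeTensorFacts_holds ComplexPoints)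
open Literature.Barriers.HodgeConjecture
open Literature.AlgebraicGeometry.Motives.HodgeStructure
open Literature.AlgebraicGeometry.Motives.AbelianVariety
open Literature.AlgebraicGeometry.ComplexMultiplication
open Literature.AlgebraicGeometry.Milne1999
open Literature.AlgebraicGeometry.Pohlmann1968
open Literature.NumberTheory.ComplexMultiplication
open Literature.RepresentationTheory.GeneralLinear
open Literature.NumberTheory.DiophantineGeometry

/-! ### §0 Tools: trace representatives on skew Hodge endomorphisms; traces of diagonal operators -/

section Tools

universe u

variable {V : Type u} [AddCommGroup V] [Module ℚ V] [Module.Finite ℚ V] {n : ℤ}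

/-- **(ND) Every rational linear functional on `End_ℚ(V)` is represented on a subspace `𝔷` of `ψ`-skew Hodge endomorphisms
by a trace functional `Tr(a ·)`, `a ∈ 𝔷`**: the trace form `(a, x) ↦ Tr(a x)` is NEGATIVE DEFINITE on `𝔷` — for `a ≠ 0`
skew, `a† = −a` and `Tr(a a†) > 0` (positivity of the Rosati involution, `Polarization.trace_mul_adjoint_self_pos`) — hence
non-degenerate, and `LinearMap.BilinForm.toDual` inverts it. Moonen–Zarhin §1: «the centre of `Hg` is a torus on which the
Rosati involution acts by inversion». [cite: MoonenZarhin1999LowDim, §1] [cite: MumfordAV1970, §21] -/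
theorem exists_trace_representative_of_skew (H : Motives.HodgeStructure V n) (ψ : H.Polarization)
    (𝔷 : Submodule ℚ (Module.End ℚ V)) (h𝔷E : ∀ a ∈ 𝔷, a ∈ H.endAlg)
    (h𝔷skew : ∀ a ∈ 𝔷, ∀ v w, ψ.form (a v) w + ψ.form v (a w) = 0) (ℓ : Module.End ℚ V →ₗ[ℚ] ℚ) :
    ∃ a ∈ 𝔷, ∀ x ∈ 𝔷, ℓ x = LinearMap.trace ℚ V (a * x) := by
  classical
  -- the trace form on `𝔷`
  set B : LinearMap.BilinForm ℚ 𝔷 := LinearMap.mk₂ ℚ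
    (fun a x : 𝔷 => LinearMap.trace ℚ V ((a : Module.End ℚ V) * (x : Module.End ℚ V)))
    (fun a a' x => by rw [Submodule.coe_add, add_mul, map_add])
    (fun r a x => by rw [Submodule.coe_smul, smul_mul_assoc, map_smul, smul_eq_mul])
    (fun a x x' => by rw [Submodule.coe_add, mul_add, map_add])
    (fun r a x => by rw [Submodule.coe_smul, mul_smul_comm, map_smul, smul_eq_mul]) with hBdef
  have hB : ∀ a x : 𝔷, B a x = LinearMap.trace ℚ V ((a : Module.End ℚ V) * (x : Module.End ℚ V)) := fun a x => rfl
  -- negative definiteness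
  have hdef : ∀ a : 𝔷, B a a = 0 → a = 0 := by
    intro a ha
    by_contra ha0
    have ha0' : (a : Module.End ℚ V) ≠ 0 := fun h => ha0 (Subtype.ext h)
    have hadj : ψ.adjoint (a : Module.End ℚ V) = -(a : Module.End ℚ V) := by
      refine (ψ.eq_adjoint_of_isAdjointPair fun v w => ?_).symm
      rw [LinearMap.neg_apply, map_neg, eq_neg_iff_add_eq_zero]
      exact h𝔷skew a a.2 v w
    have ha' : LinearMap.trace ℚ V ((a : Module.End ℚ V) * (a : Module.End ℚ V)) = 0 := by rw [← hB]; exact ha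
    have hpos := ψ.trace_mul_adjoint_self_pos (h𝔷E a a.2) ha0'
    rw [hadj, mul_neg, map_neg, ha', neg_zero] at hpos
    exact lt_irrefl _ hpos
  have hN : B.Nondegenerate := ⟨fun a ha => hdef a (ha a), fun a ha => hdef a (ha a)⟩
  obtain ⟨a, ha⟩ : ∃ a : 𝔷, ∀ x : 𝔷, B a x = ℓ (x : Module.End ℚ V) :=
    ⟨(B.toDual hN).symm (ℓ ∘ₗ 𝔷.subtype), fun x => by
      rw [LinearMap.BilinForm.apply_toDual_symm_apply, LinearMap.comp_apply, Submodule.subtype_apply]⟩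
  exact ⟨a, a.2, fun x hx => by rw [← hB a ⟨x, hx⟩, ha ⟨x, hx⟩]⟩

omit [Module.Finite ℚ V] in
/-- **The trace of an operator diagonal in a basis is the sum of its diagonal weights.** [folklore] -/
private theorem trace_eq_sum_of_apply_basis_eq_smul {ι : Type*} [Fintype ι] [DecidableEq ι] {W : Type*} [AddCommGroup W]
    [Module ℂ W] (b : Module.Basis ι ℂ W) (T : Module.End ℂ W) (d : ι → ℂ) (hT : ∀ i, T (b i) = d i • b i) :
    LinearMap.trace ℂ W T = ∑ i, d i := by
  rw [LinearMap.trace_eq_matrix_trace ℂ b, Matrix.trace]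
  refine Finset.sum_congr rfl fun i _ => ?_
  rw [Matrix.diag_apply, LinearMap.toMatrix_apply, hT, map_smul, Module.Basis.repr_self, Finsupp.smul_apply,
    Finsupp.single_eq_same, smul_eq_mul, mul_one]

end Tools

/-! ### §1 The invariance theorem for slots over `Y × S` (quartic CM centre × simple CM surface, non-aligned) -/

section Invariance

variable {A C X : AbelianVariety ℂ} {n : ℕ} {g : Fin n → (X ⟶ A.prod C)}

/-- The two elements of `Fin 2`. [folklore] -/
private theorem fin2_eq_zero_or_one_cs (r : Fin 2) : r = 0 ∨ r = 1 := by
  fin_cases r <;> simp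

set_option maxHeartbeats 800000 in
open scoped Classical in
/-- **The INVARIANCE THEOREM for slots over `Y × S`** (`Y` written `A`, `S` written `C`): `A` a SIMPLE abelian fourfold with
`finrank_ℚ End⁰(A) = 4` and `φ ∈ End(A)` whose eigenvalues on `H^{1,0}(A)` are `μ₁` (multiplicity `1`), `μ̄₁` (`1`), `μ₂` (`2`),
with `μ₁, μ̄₁, μ₂, μ̄₂` pairwise distinct (so `E = End⁰(A) = ℚ(φ)` is a quartic CM field of signature `{(2,0),(1,1)}`); `C` a SIMPLE
abelian surface realising the CM type `Φ` of the quartic CM field `K`; and (hNA) no non-zero purely imaginary number common to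
`ℚ(μ₂)` and the reflex field `traceField Φ`. CONCLUSION = that of R28b's
`AVSlots.exists_coeff_eq_zero_off_balanced_of_prod_quadraticEnd_simpleCMSurface`: Hodge-adapted pair bases of `H¹(A) ⊗ ℂ`
and (the `K`-eigenbasis) of `H¹(C) ⊗ ℂ` such that every rational `(p,p)`-class on `X` (slots `g` over `A × C`) has a letter
expansion VANISHING off the `A`-kind-balanced words — «`Hg(A × C) = Hg(A) × Hg(C)`» read on tensor invariants. Proof: R28b
verbatim with the Lie step `wordDerAt_incl_theta_proj_eq_zero_of_centre_times_torus_of_traceNonAligned` ((Z1) with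
`𝔷₁ = {ψ-skew Hodge endomorphisms of H¹(A)}`, (ND₁)∕(ND₂) by `exists_trace_representative_of_skew`, (NA) discharged as in the
module docstring). [cite: MoonenZarhin1999LowDim, §3 (3.1) and Lemma (3.6)] [cite: Deligne1982HodgeCycles, I §3 Prop. 3.4 and Prop. 3.6]
[cite: Lombardo2016, Lemma 3.4 (p. 1229)] [cite: Shimura1998, §8.3 Prop. 28] -/
theorem AVSlots.exists_coeff_eq_zero_off_balanced_of_prod_quarticCentre_simpleCMSurface (hg : AVSlots (A.prod C) X g)
    (hAs : A.IsSimple) (φA : A ⟶ A) (hE4 : Module.finrank ℚ A.endAlgebra = 4) {μ₁ μ₂ : ℂ}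
    (h11 : starRingEnd ℂ μ₁ ≠ μ₁) (h22 : starRingEnd ℂ μ₂ ≠ μ₂) (h12 : μ₂ ≠ μ₁) (h12' : μ₂ ≠ starRingEnd ℂ μ₁)
    (h1 : eigenMultiplicity A φA μ₁ = 1) (h1' : eigenMultiplicity A φA (starRingEnd ℂ μ₁) = 1)
    (h2 : eigenMultiplicity A φA μ₂ = 2) (hdim : A.dim = 4)
    {K : Type} [Field K] [NumberField K] [IsCMField K] {Φ : CMType K} {ιC : 𝓞 K →+* End C}
    {θ : K →+* Module.End ℂ (complexBetti C.X 1)} (hreal : IsCMTypeRealisation Φ C ιC θ)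
    (hK4 : Module.finrank ℚ K = 4) (hCs : C.IsSimple)
    (hNA : ∀ w : ℂ, w ∈ IntermediateField.adjoin ℚ {μ₂} → w ∈ traceField Φ → starRingEnd ℂ w = -w → w = 0) :
    ∃ (hA : ℕ) (bA : Module.Basis (Fin hA × Fin 2) ℂ (ℂ ⊗[ℚ] bettiCohomology A.X 1))
      (cC : Module.Basis (Fin 2 × Fin 2) ℂ (ℂ ⊗[ℚ] bettiCohomology C.X 1)),
      (∀ i, IsOfHodgeType A.dim A.X 1 1 0 (ofRatClassBaseChange (Motives.ComplexPoints A.X) 1 (bA (i, 0)))) ∧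
      (∀ i, IsOfHodgeType A.dim A.X 1 0 1 (ofRatClassBaseChange (Motives.ComplexPoints A.X) 1 (bA (i, 1)))) ∧
      (∀ i, IsOfHodgeType C.dim C.X 1 1 0 (ofRatClassBaseChange (Motives.ComplexPoints C.X) 1 (cC (i, 0)))) ∧
      (∀ i, IsOfHodgeType C.dim C.X 1 0 1 (ofRatClassBaseChange (Motives.ComplexPoints C.X) 1 (cC (i, 1)))) ∧
      ∀ {p : ℕ}, 0 < p → ∀ {c : complexBetti X.X (2 * p)}, IsRationalClass c →
        IsOfHodgeType X.dim X.X (2 * p) p p c →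
        ∃ a : (Fin (2 * p) → (Fin n × (Fin hA ⊕ Fin 2)) × Fin 2) → ℂ,
          wordEval (cupPowOneAlt ℂ (Motives.ComplexPoints X.X) (2 * p))
            (fun jr : (Fin n × (Fin hA ⊕ Fin 2)) × Fin 2 => complexBetti.map (g jr.1.1).hom.hom.hom 1
              (Sum.elim
                (fun i => complexBetti.map (Motives.AbelianVariety.fst A C).hom.hom.hom 1
                  (ofRatClassBaseChange (Motives.ComplexPoints A.X) 1 (bA (i, jr.2))))
                (fun i => complexBetti.map (Motives.AbelianVariety.snd A C).hom.hom.hom 1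
                  (ofRatClassBaseChange (Motives.ComplexPoints C.X) 1 (cC (i, jr.2))))
                jr.1.2)) a = c ∧
          ∀ (U : Fin (2 * p) → Fin n × (Fin hA ⊕ Fin 2)) (η : Fin (2 * p) → Fin 2),
            (∑ t, Sum.elim (fun _ : Fin hA => if η t = 0 then (1 : ℂ) else -1) (fun _ : Fin 2 => (0 : ℂ)) (U t).2) ≠ 0 →
            a (fun t => (U t, η t)) = 0 := by
  classical
  -- the setting
  have hHD : exists_isReal_hodgeModel := exists_isReal_hodgeModel_holds
  have hI : hodgePQ_independent_of_hodgeModel := hodgePQ_independent_of_hodgeModel_holds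
  haveI : HodgeTensorFacts.{0, 0} := hodgeTensorFacts_holds.{0, 0}
  have hXA : IsSmoothProjective A.dim A.X := AbelianVariety.isSmoothProjective_holds
  have hXC : IsSmoothProjective C.dim C.X := AbelianVariety.isSmoothProjective_holds
  have hXP : IsSmoothProjective (A.prod C).dim (A.prod C).X := AbelianVariety.isSmoothProjective_holds
  haveI : Module.Finite ℚ (bettiCohomology A.X 1) := finite_bettiCohomology_one A
  haveI : Module.Finite ℚ (bettiCohomology C.X 1) := finite_bettiCohomology_one C
  haveI : Module.Finite ℚ (bettiCohomology (A.prod C).X 1) := finite_bettiCohomology_one (A.prod C)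
  have hn1 : (((1 : ℕ) : ℤ)) = 1 := by norm_num
  -- the pair bases of `H¹(A) ⊗ ℂ` and `H¹(C) ⊗ ℂ`
  obtain ⟨hA, bA, hbA0, hbA1⟩ := exists_hodgeAdapted_pairBasis (BettiUniverse.hodge hHD hXA 1) (by norm_num)
    (BettiUniverse.hodge_isEffective hHD hXA 1)
  have hbA0' : ∀ i, bA (i, 0) ∈ (BettiUniverse.hodge hHD hXA 1).piece 1 0 := fun i => by simpa using hbA0 i
  have hbA1' : ∀ i, bA (i, 1) ∈ (BettiUniverse.hodge hHD hXA 1).piece 0 1 := fun i => by simpa using hbA1 i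
  -- the `K`-action on `H¹(C; ℚ)`, its eigenbasis, and the pair indexing `(i, 0) ↦ σᵢ ∈ Φ`, `(i, 1) ↦ σ̄ᵢ`
  have hθ : BettiUniverse.IsInducedOnIntegers θ := hreal.isInducedOnIntegers
  set Acm := BettiUniverse.cmEndAction θ hθ hHD hI hXC with hAcm
  obtain ⟨bK, hbK⟩ := CommonReflex.exists_basis_mem_eigenline_complexify hreal hθ
  have hbKmem : ∀ σ : K →+* ℂ, bK σ ∈ ⨅ e : K, Module.End.eigenspace ((Acm.ι e).baseChange ℂ) (σ e) :=
    fun σ => hbK σ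
  have hbKev : ∀ (σ : K →+* ℂ) (e : K), (Acm.ι e).baseChange ℂ (bK σ) = σ e • bK σ :=
    fun σ e => (Acm.mem_iInf_eigenspace_iff σ _).1 (hbKmem σ) e
  have hdimK : Module.finrank ℚ K / 2 = C.dim := by
    rw [finrank_eq_two_mul_dim_of_isCMTypeRealisation hreal]; omega
  have hbK10 : ∀ σ ∈ Φ.1, bK σ ∈ (BettiUniverse.hodge hHD hXC 1).piece 1 0 := by
    intro σ hσ
    refine (BettiUniverse.mem_hodge_piece_iff hHD hI hXC (k := 1) (p := 1) (q := 0) rfl _).2 ?_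
    have h10 := (hreal.2.2.2 σ).2.1 hσ _ (BettiUniverse.ofRatClassBaseChange_mem_eigenline θ hθ hHD hI hXC σ (hbKmem σ))
    rwa [hdimK] at h10
  have hbK01 : ∀ σ ∉ Φ.1, bK σ ∈ (BettiUniverse.hodge hHD hXC 1).piece 0 1 := by
    intro σ hσ
    refine (BettiUniverse.mem_hodge_piece_iff hHD hI hXC (k := 1) (p := 0) (q := 1) rfl _).2 ?_
    have h01 := (hreal.2.2.2 σ).2.2 hσ _ (BettiUniverse.ofRatClassBaseChange_mem_eigenline θ hθ hHD hI hXC σ (hbKmem σ))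
    rwa [hdimK] at h01
  -- `Φ = {x, y}`, the four embeddings `x, y, x̄, ȳ`
  obtain ⟨σ₀⟩ : Nonempty (K →+* ℂ) := inferInstance
  obtain ⟨x, hx⟩ : ∃ x : K →+* ℂ, x ∈ Φ.1 :=
    (CMTypeOps.mem_or_conjugate_mem Φ σ₀).elim (fun h0 => ⟨_, h0⟩) (fun h0 => ⟨_, h0⟩)
  obtain ⟨y, hyx, hyx', hΦ⟩ := exists_eq_pair_of_finrank_eq_four hK4 Φ hx
  set e0 : Fin 2 → (K →+* ℂ) := ![x, y] with he0
  have he0mem : ∀ i, e0 i ∈ Φ.1 := fun i => by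
    rcases fin2_eq_zero_or_one_cs i with h0 | h1
    · rw [h0]; exact hx
    · rw [h1, hΦ]; exact Or.inr rfl
  have he0inj : Function.Injective e0 := by
    intro i j hij
    rcases fin2_eq_zero_or_one_cs i with hi | hi <;> rcases fin2_eq_zero_or_one_cs j with hj | hj <;> subst hi <;> subst hj
    · rfl
    · exact absurd hij.symm hyx
    · exact absurd hij hyx
    · rfl
  set emb : Fin 2 × Fin 2 → (K →+* ℂ) :=
    fun ir => if ir.2 = 0 then e0 ir.1 else ComplexEmbedding.conjugate (e0 ir.1) with hemb
  have hemb0eq : ∀ i, emb (i, 0) = e0 i := fun i => if_pos rfl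
  have hemb1eq : ∀ i, emb (i, 1) = ComplexEmbedding.conjugate (e0 i) := fun i => if_neg one_ne_zero
  have hemb0 : ∀ i, emb (i, 0) ∈ Φ.1 := fun i => by rw [hemb0eq]; exact he0mem i
  have hemb1 : ∀ i, emb (i, 1) ∉ Φ.1 := fun i => by
    rw [hemb1eq]; exact (CMTypeOps.mem_iff_conjugate_notMem Φ _).1 (he0mem i)
  have hembinj : Function.Injective emb := by
    rintro ⟨i, r⟩ ⟨j, t⟩ hij
    rcases fin2_eq_zero_or_one_cs r with hr | hr <;> rcases fin2_eq_zero_or_one_cs t with ht | ht <;> subst hr <;> subst ht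
    · rw [hemb0eq, hemb0eq] at hij
      rw [he0inj hij]
    · exact absurd (hemb0 i) (by rw [hij]; exact hemb1 j)
    · exact absurd (hemb0 j) (by rw [← hij]; exact hemb1 i)
    · rw [hemb1eq, hemb1eq] at hij
      rw [he0inj ((ComplexEmbedding.involutive_conjugate K).injective hij)]
  have hembbij : Function.Bijective emb := by
    rw [Fintype.bijective_iff_injective_and_card]
    refine ⟨hembinj, ?_⟩
    rw [Fintype.card_prod, Fintype.card_fin, Embeddings.card, hK4]
  set fK : Fin 2 × Fin 2 ≃ (K →+* ℂ) := Equiv.ofBijective emb hembbij with hfK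
  set cC : Module.Basis (Fin 2 × Fin 2) ℂ (ℂ ⊗[ℚ] bettiCohomology C.X 1) := bK.reindex fK.symm with hcCdef
  have hcC : ∀ ir, cC ir = bK (emb ir) := fun ir => by
    rw [hcCdef, Module.Basis.reindex_apply, Equiv.symm_symm, hfK, Equiv.ofBijective_apply]
  have hcCev : ∀ ir (e : K), (Acm.ι e).baseChange ℂ (cC ir) = (emb ir) e • cC ir := fun ir e => by
    rw [hcC]; exact hbKev _ e
  have hcC0' : ∀ i, cC (i, 0) ∈ (BettiUniverse.hodge hHD hXC 1).piece 1 0 := fun i => by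
    rw [hcC]; exact hbK10 _ (hemb0 i)
  have hcC1' : ∀ i, cC (i, 1) ∈ (BettiUniverse.hodge hHD hXC 1).piece 0 1 := fun i => by
    rw [hcC]; exact hbK01 _ (hemb1 i)
  -- `K⁻`, the operators `𝔲 = (K⁻)^*`, a compatible polarization, the eigenline condition, (NOSQ)
  obtain ⟨S, hS⟩ : ∃ S : Submodule ℚ K, ∀ z : K, z ∈ S ↔ IsCMField.complexConj K z = -z :=
    ⟨{ carrier := {z | IsCMField.complexConj K z = -z}
       add_mem' := fun {a b} ha hb => by
         simp only [Set.mem_setOf_eq] at ha hb ⊢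
         rw [map_add, ha, hb, neg_add]
       zero_mem' := by simp
       smul_mem' := fun c z hz => by
         simp only [Set.mem_setOf_eq] at hz ⊢
         rw [map_rat_smul, hz, smul_neg] }, fun z => Iff.rfl⟩
  set 𝔲 : Submodule ℚ (Module.End ℚ (bettiCohomology C.X 1)) := S.map Acm.ι.toLinearMap with h𝔲
  have hpolC : (BettiUniverse.hodge hHD (AbelianVariety.isSmoothProjective_holds (A := C)) 1).IsPolarizable :=
    smoothProjective_hodgeStructure_isPolarizable_holds hXC (BettiUniverse.realHodgeModel hHD hXC)
      (BettiUniverse.realHodgeModel_isHodgeSymmetric hHD hXC) 1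
  obtain ⟨ψC, hcompat⟩ := EndAction.IsPolarizable.exists_isCompatible Acm hpolC
  have hline : ∀ σ : K →+* ℂ,
      Module.finrank ℂ ↥(⨅ e : K, Module.End.eigenspace ((Acm.ι e).baseChange ℂ) (σ e)) = 1 :=
    fun σ => BettiUniverse.finrank_eigenLine_eq_one θ hθ hHD hI hXC σ (hreal.2.2.2 σ).1
  have hnosqK : ∀ z : K, IsCMField.complexConj K z = -z → z ≠ 0 → ∀ r : ℚ, z * z ≠ algebraMap ℚ K r :=
    fun z hz hz0 r => mul_self_ne_algebraMap_of_isSimple_of_isCMTypeRealisation hK4 hreal hCs hz hz0 r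
  haveI : Nontrivial (bettiCohomology C.X 1) := by
    apply Module.nontrivial_of_finrank_pos (R := ℚ)
    rw [finrank_bettiCohomology_one C, ← hdimK, hK4]
    norm_num
  refine ⟨hA, bA, cC, fun i => ?_, fun i => ?_, fun i => ?_, fun i => ?_, ?_⟩
  · exact (BettiUniverse.mem_hodge_piece_iff hHD hI hXA (k := 1) (p := 1) (q := 0) rfl _).1 (hbA0' i)
  · exact (BettiUniverse.mem_hodge_piece_iff hHD hI hXA (k := 1) (p := 0) (q := 1) rfl _).1 (hbA1' i)
  · exact (BettiUniverse.mem_hodge_piece_iff hHD hI hXC (k := 1) (p := 1) (q := 0) rfl _).1 (hcC0' i)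
  · exact (BettiUniverse.mem_hodge_piece_iff hHD hI hXC (k := 1) (p := 0) (q := 1) rfl _).1 (hcC1' i)
  intro p hp c hcQ hc
  -- the presentation `H¹(A × C) = pr_A^* H¹(A) ⊕ pr_C^* H¹(C)` and its complexification
  set ι₁ := HOneProduct.pullFst A C with hι₁
  set π₁ := HOneProduct.pullInl A C with hπ₁
  set ι₂ := HOneProduct.pullSnd A C with hι₂
  set π₂ := HOneProduct.pullInr A C with hπ₂
  have hπι₁ : π₁ ∘ₗ ι₁ = LinearMap.id := HOneProduct.pullInl_comp_pullFst
  have hπι₂ : π₂ ∘ₗ ι₂ = LinearMap.id := HOneProduct.pullInr_comp_pullSnd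
  have hπ₁ι₂ : π₁ ∘ₗ ι₂ = 0 := HOneProduct.pullInl_comp_pullSnd
  have hπ₂ι₁ : π₂ ∘ₗ ι₁ = 0 := HOneProduct.pullInr_comp_pullFst
  have hsum : ι₁ ∘ₗ π₁ + ι₂ ∘ₗ π₂ = LinearMap.id := HOneProduct.pullFst_comp_pullInl_add
  have hπι₁C : π₁.baseChange ℂ ∘ₗ ι₁.baseChange ℂ = LinearMap.id := by
    rw [← LinearMap.baseChange_comp, hπι₁, LinearMap.baseChange_id]
  have hπι₂C : π₂.baseChange ℂ ∘ₗ ι₂.baseChange ℂ = LinearMap.id := by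
    rw [← LinearMap.baseChange_comp, hπι₂, LinearMap.baseChange_id]
  have hπ₁ι₂C : π₁.baseChange ℂ ∘ₗ ι₂.baseChange ℂ = 0 := by
    rw [← LinearMap.baseChange_comp, hπ₁ι₂, LinearMap.baseChange_zero]
  have hπ₂ι₁C : π₂.baseChange ℂ ∘ₗ ι₁.baseChange ℂ = 0 := by
    rw [← LinearMap.baseChange_comp, hπ₂ι₁, LinearMap.baseChange_zero]
  have hsumC : ι₁.baseChange ℂ ∘ₗ π₁.baseChange ℂ + ι₂.baseChange ℂ ∘ₗ π₂.baseChange ℂ = LinearMap.id := by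
    rw [← LinearMap.baseChange_comp, ← LinearMap.baseChange_comp, ← LinearMap.baseChange_add, hsum,
      LinearMap.baseChange_id]
  -- piece compatibility of `pr_A^*`, `pr_C^*` (pull-backs are morphisms of Hodge structures)
  have hι₁F : ∀ q : ℤ, ∀ x ∈ (BettiUniverse.hodge hHD hXA 1).piece q (((1 : ℕ) : ℤ) - q), ι₁.baseChange ℂ x ∈ (BettiUniverse.hodge hHD hXP 1).piece q (((1 : ℕ) : ℤ) - q) :=
    fun q x hx => (BettiUniverse.pullHodgeHom hHD hI hXP hXA (Motives.AbelianVariety.fst A C).hom.hom.hom 1).map_piece_le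
      q _ ⟨x, hx, rfl⟩
  have hι₂F : ∀ q : ℤ, ∀ x ∈ (BettiUniverse.hodge hHD hXC 1).piece q (((1 : ℕ) : ℤ) - q), ι₂.baseChange ℂ x ∈ (BettiUniverse.hodge hHD hXP 1).piece q (((1 : ℕ) : ℤ) - q) :=
    fun q x hx => (BettiUniverse.pullHodgeHom hHD hI hXP hXC (Motives.AbelianVariety.snd A C).hom.hom.hom 1).map_piece_le
      q _ ⟨x, hx, rfl⟩
  -- §1: the basis `cbx` of `H¹(A × C) ⊗ ℂ` in pairs: `pr_A^* b_i^r` and `pr_C^* c_i^r`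
  obtain ⟨cbx', hcbx'l, hcbx'r⟩ := exists_basis_of_presentation hπι₁C hπι₂C hπ₁ι₂C hπ₂ι₁C hsumC bA cC
  set cbx : Module.Basis ((Fin hA ⊕ Fin 2) × Fin 2) ℂ (ℂ ⊗[ℚ] bettiCohomology (A.prod C).X 1) :=
    cbx'.reindex (Equiv.sumProdDistrib (Fin hA) (Fin 2) (Fin 2)).symm with hcbxdef
  have hcbx : ∀ tr : (Fin hA ⊕ Fin 2) × Fin 2, cbx tr =
      Sum.elim (fun i => ι₁.baseChange ℂ (bA (i, tr.2))) (fun i => ι₂.baseChange ℂ (cC (i, tr.2))) tr.1 := by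
    rintro ⟨t, r⟩
    rw [hcbxdef, Module.Basis.reindex_apply, Equiv.symm_symm]
    rcases t with i | i
    · rw [Equiv.sumProdDistrib_apply_left, hcbx'l]; rfl
    · rw [Equiv.sumProdDistrib_apply_right, hcbx'r]; rfl
  -- Hodge-adaptedness of `cbx`
  have hcbx0 : ∀ t, cbx (t, 0) ∈ (BettiUniverse.hodge hHD hXP 1).piece 1 0 := by
    intro t
    rw [hcbx]
    rcases t with i | i
    · exact hι₁F 1 _ (by simpa using hbA0' i)
    · exact hι₂F 1 _ (by simpa using hcC0' i)
  have hcbx1 : ∀ t, cbx (t, 1) ∈ (BettiUniverse.hodge hHD hXP 1).piece 0 1 := by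
    intro t
    rw [hcbx]
    rcases t with i | i
    · have e : (((1 : ℕ) : ℤ) - 0) = 1 := by norm_num
      have h01 := hι₁F 0 _ (by rw [e]; exact hbA1' i)
      rwa [e] at h01
    · have e : (((1 : ℕ) : ℤ) - 0) = 1 := by norm_num
      have h01 := hι₂F 0 _ (by rw [e]; exact hcC1' i)
      rwa [e] at h01
  -- bases indexed by `Fin M`: the pair basis `cbσ` and the rational basis `eC`
  set eQ := Module.finBasis ℚ (bettiCohomology (A.prod C).X 1) with heQ
  set eC : Module.Basis (Fin (Module.finrank ℚ (bettiCohomology (A.prod C).X 1))) ℂ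
    (ℂ ⊗[ℚ] bettiCohomology (A.prod C).X 1) := Algebra.TensorProduct.basis ℂ eQ with heC
  set φ : Fin (Module.finrank ℚ (bettiCohomology (A.prod C).X 1)) ≃ (Fin hA ⊕ Fin 2) × Fin 2 :=
    eC.indexEquiv cbx with hφ
  set cbσ : Module.Basis (Fin (Module.finrank ℚ (bettiCohomology (A.prod C).X 1))) ℂ
    (ℂ ⊗[ℚ] bettiCohomology (A.prod C).X 1) := cbx.reindex φ.symm with hcbσdef
  have hcbσ : ∀ m, cbσ m = cbx (φ m) := fun m => by
    rw [hcbσdef, Module.Basis.reindex_apply, Equiv.symm_symm]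
  -- letters
  set ρ := ofRatClassBaseChangeEquiv hXP 1 with hρ
  set v : Module.Basis _ ℂ (complexBetti (A.prod C).X 1) := cbσ.map ρ with hv
  set eL : Module.Basis _ ℂ (complexBetti (A.prod C).X 1) := eC.map ρ with heL
  have heLQ : ∀ i, IsRationalClass (eL i) := fun i => by
    rw [heL, Module.Basis.map_apply, heC, Algebra.TensorProduct.basis_apply, hρ,
      ofRatClassBaseChangeEquiv_apply, ofRatClassBaseChange_tmul, one_smul]
    exact isRationalClass_ofRatClass _
  set κ : Fin (Module.finrank ℚ (bettiCohomology (A.prod C).X 1)) → Fin 2 := fun m => (φ m).2 with hκ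
  have hv_apply : ∀ m, v m = ofRatClassBaseChange (Motives.ComplexPoints (A.prod C).X) 1 (cbx (φ m)) := fun m => by
    rw [hv, Module.Basis.map_apply, hcbσ, hρ, ofRatClassBaseChangeEquiv_apply]
  have hv0 : ∀ m, κ m = 0 → IsOfHodgeType (A.prod C).dim (A.prod C).X 1 1 0 (v m) := by
    intro m hm
    rw [hv_apply, ← BettiUniverse.mem_hodge_piece_iff hHD hI hXP (k := 1) (p := 1) (q := 0) rfl]
    have hsplit : φ m = ((φ m).1, 0) := by
      change (φ m).2 = 0 at hm; rw [← hm]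
    rw [hsplit]
    exact hcbx0 _
  have hv1 : ∀ m, κ m = 1 → IsOfHodgeType (A.prod C).dim (A.prod C).X 1 0 1 (v m) := by
    intro m hm
    rw [hv_apply, ← BettiUniverse.mem_hodge_piece_iff hHD hI hXP (k := 1) (p := 0) (q := 1) rfl]
    have hsplit : φ m = ((φ m).1, 1) := by
      change (φ m).2 = 1 at hm; rw [← hm]
    rw [hsplit]
    exact hcbx1 _
  -- (α) an antisymmetric kind-balanced coefficient function in the adapted letters
  obtain ⟨ax, hax_bal, hax_anti, hcax⟩ := hg.exists_antisymm_kindBalanced_wordEval_eq v κ hv0 hv1 hp hc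
  -- the change of letters to the rational letters
  set G : Matrix _ _ ℂ := eC.toMatrix cbσ with hG
  set G' : Matrix _ _ ℂ := cbσ.toMatrix eC with hG'
  have hG'G : G' * G = 1 := cbσ.toMatrix_mul_toMatrix_flip eC
  have hve : ∀ m, v m = ∑ i, G i m • eL i := fun m => by
    simp only [hv, heL, Module.Basis.map_apply, ← map_smul, ← map_sum]
    congr 1
    exact (eC.sum_toMatrix_smul_self (v := ⇑cbσ) (j := m)).symm
  have hletters : ∀ j m, avLetters g v (j, m) = ∑ i, G i m • avLetters g eL (j, i) :=
    avLetters_baseChange g G hve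
  set aE := colourChangeAt (fun _ : Fin n => G) ax with haE
  have haE_anti : IsAntisymm aE := hax_anti.colourChangeAt _
  have hcaE : wordEval (cupPowOneAlt ℂ (Motives.ComplexPoints X.X) (2 * p)) (avLetters g eL) aE = c := by
    rw [haE, ← wordEval_eq_wordEval_colourChangeAt _ (fun _ : Fin n => G) hletters ax, hcax]
  -- rationality of `aE`
  have hFinj : Function.Injective (exteriorPower.alternatingMapLinearEquiv
      (cupPowOneAlt ℂ (Motives.ComplexPoints X.X) (2 * p))) :=
    injective_alternatingMapLinearEquiv_cupPowOneAlt X (2 * p)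
  obtain ⟨q, hq⟩ := hg.exists_rat_wordEval_eq eL heLQ hcQ
  obtain ⟨q', -, haEq⟩ := haE_anti.exists_eq_algebraMap_of_wordEval_eq hFinj (hg.letterBasis eL)
    (q := q) (by rw [AVSlots.coe_letterBasis, hcaE, hq])
  have hslice_e : ∀ u, wordSlice aE u = wordRepAt ℂ (fun _ : Fin (2 * p) => G) (wordSlice ax u) :=
    fun u => wordSlice_colourChangeAt (fun _ : Fin n => G) ax u
  -- the Hodge operator `Θ` of `H¹(A × C)`: `diag(±1)` in the adapted letters
  obtain ⟨Θ, hΘ⟩ := exists_hodgeTheta (BettiUniverse.hodge hHD hXP 1)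
  have hΘb : ∀ m, Θ (cbσ m) = (if κ m = 0 then (1 : ℂ) else -1) • cbσ m := by
    intro m
    rw [hcbσ]
    change Θ _ = (if (φ m).2 = 0 then (1 : ℂ) else -1) • _
    rcases fin2_eq_zero_or_one_cs (φ m).2 with h0 | h1
    · rw [h0, if_pos rfl]
      have hmem : cbx (φ m) ∈ (BettiUniverse.hodge hHD hXP 1).piece 1 (((1 : ℕ) : ℤ) - 1) := by
        have e : (((1 : ℕ) : ℤ) - 1) = 0 := by norm_num
        have hsplit : φ m = ((φ m).1, 0) := by rw [← h0]
        rw [e, hsplit]; exact hcbx0 _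
      rw [hΘ 1 _ hmem]
      norm_num
    · rw [h1, if_neg one_ne_zero]
      have hmem : cbx (φ m) ∈ (BettiUniverse.hodge hHD hXP 1).piece 0 (((1 : ℕ) : ℤ) - 0) := by
        have e : (((1 : ℕ) : ℤ) - 0) = 1 := by norm_num
        have hsplit : φ m = ((φ m).1, 1) := by rw [← h1]
        rw [e, hsplit]; exact hcbx1 _
      rw [hΘ 0 _ hmem]
      norm_num
  have hΘcb : LinearMap.toMatrix cbσ cbσ Θ = kindDiag κ := by
    ext i m
    rw [LinearMap.toMatrix_apply, hΘb, map_smul, Module.Basis.repr_self, Finsupp.smul_apply,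
      Finsupp.single_apply, kindDiag, Matrix.diagonal_apply, smul_eq_mul, mul_ite, mul_one, mul_zero]
    by_cases him : i = m
    · subst him; rw [if_pos rfl]
    · rw [if_neg (Ne.symm him), if_neg him]
  have hJG : LinearMap.toMatrix eC eC Θ * G = G * kindDiag κ := by
    rw [← hΘcb, hG, linearMap_toMatrix_mul_basis_toMatrix, basis_toMatrix_mul_linearMap_toMatrix]
  have hΘq : ∀ u : Fin (2 * p) → Fin n, wordDerAt ℂ (fun _ : Fin (2 * p) => LinearMap.toMatrix eC eC Θ)
      (wordSlice (fun w => algebraMap ℚ ℂ (q' w)) u) = 0 := by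
    intro u
    rw [← haEq, hslice_e]
    refine wordDerAt_wordRepAt_eq_zero_of_mul_eq ℂ (fun _ : Fin (2 * p) => G) (fun _ => hJG) ?_
    rw [wordDerAt_const]
    exact wordDer_kindDiag_wordSlice_eq_zero κ hax_bal u
  -- a polarization of `H¹(A)`
  obtain ⟨ψ⟩ : (BettiUniverse.hodge hHD (AbelianVariety.isSmoothProjective_holds (A := A)) 1).IsPolarizable :=
    smoothProjective_hodgeStructure_isPolarizable_holds hXA (BettiUniverse.realHodgeModel hHD hXA)
      (BettiUniverse.realHodgeModel_isHodgeSymmetric hHD hXA) 1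
  -- the Hodge operators `Θ_A`, `Θ_C` and the partial Hodge operator `Y = pr_A^* ∘ Θ_A ∘ ι_A^*`
  obtain ⟨ΘA, hΘA⟩ := exists_hodgeTheta (BettiUniverse.hodge hHD hXA 1)
  obtain ⟨ΘC, hΘC⟩ := exists_hodgeTheta (BettiUniverse.hodge hHD hXC 1)
  set Y := ι₁.baseChange ℂ ∘ₗ ΘA ∘ₗ π₁.baseChange ℂ with hY
  -- the `A`-side: the quartic CM datum `φQ = φ^*` on `H¹(A)`, `End_Hdg(H¹(A)) = ℚ[φQ] = E`, eigenvalues `μ₁, μ̄₁, μ₂, μ̄₂`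
  have heffA := BettiUniverse.hodge_isEffective hHD hXA 1
  set φQ : Module.End ℚ (bettiCohomology A.X 1) := (bettiCohomology.map φA.hom.hom.hom 1).hom with hφQ
  have hφE : φQ ∈ (BettiUniverse.hodge hHD hXA 1).endAlg := by
    have h := unop_bettiRep_mem_endAlg hHD hI (AbelianVariety.endAlgebra.of A φA)
    rwa [bettiRep_of, MulOpposite.unop_op] at h
  have hVCA : Module.finrank ℂ (ℂ ⊗[ℚ] bettiCohomology A.X 1) = 8 := by
    rw [Module.finrank_baseChange, finrank_bettiCohomology_one A, hdim]
  have h21 : starRingEnd ℂ μ₂ ≠ μ₁ := fun h => h12' (by rw [← h, starRingEnd_self_apply])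
  set c4 : Fin 4 → ℂ := ![μ₁, starRingEnd ℂ μ₁, μ₂, starRingEnd ℂ μ₂] with hc4
  have hc4inj : Function.Injective c4 := by
    intro i j hij
    fin_cases i <;> fin_cases j
    all_goals simp [hc4] at hij
    all_goals first
      | rfl
      | exact absurd hij h11.symm | exact absurd hij h11 | exact absurd hij h12.symm | exact absurd hij h12
      | exact absurd hij h21.symm | exact absurd hij h21
      | exact absurd hij (fun h => h12' (by rw [← h, starRingEnd_self_apply]))
      | exact absurd hij (fun h => h12' (by rw [h, starRingEnd_self_apply]))
      | exact absurd hij (fun h => h12 (RingHom.injective _ h))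
      | exact absurd hij (fun h => h12 (RingHom.injective _ h).symm)
      | exact absurd hij h12' | exact absurd hij h12'.symm
      | exact absurd hij h22 | exact absurd hij h22.symm
  have hgrA := fun cc => CMTheta.finrank_eigenspace_eq_add (BettiUniverse.hodge hHD hXA 1) hn1 heffA hφE cc
  have h10A : ∀ cc, Module.finrank ℂ ↥(Module.End.eigenspace (φQ.baseChange ℂ) cc ⊓
      (BettiUniverse.hodge hHD hXA 1).piece 1 0) = eigenMultiplicity A φA cc := fun cc => by
    rw [hφQ, finrank_eigenspace_inf_piece_oneZero_eq_eigenMultiplicity hHD hI φA cc]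
  have h01A : ∀ cc, Module.finrank ℂ ↥(Module.End.eigenspace (φQ.baseChange ℂ) cc ⊓
      (BettiUniverse.hodge hHD hXA 1).piece 0 1) = eigenMultiplicity A φA (starRingEnd ℂ cc) := fun cc => by
    rw [hφQ, finrank_eigenspace_inf_piece_zeroOne_eq_eigenMultiplicity_conj hHD hI φA cc]
  -- the multiplicity of `μ̄₂` on `H^{1,0}` vanishes: the four eigenspaces have dimensions `2, 2, 2 + x, x + 2` inside `8`
  have h2' : eigenMultiplicity A φA (starRingEnd ℂ μ₂) = 0 := by
    have hind : iSupIndep fun j => Module.End.eigenspace (φQ.baseChange ℂ) (c4 j) :=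
      (Module.End.eigenspaces_iSupIndep (φQ.baseChange ℂ)).comp hc4inj
    have h := Motives.finrank_biSup_eq_sum_of_iSupIndep hind Finset.univ
    have hle : Module.finrank ℂ ↥(⨆ j ∈ (Finset.univ : Finset (Fin 4)), Module.End.eigenspace (φQ.baseChange ℂ) (c4 j)) ≤ 8 := by
      rw [← hVCA]; exact Submodule.finrank_le _
    rw [h, Fin.sum_univ_four] at hle
    simp only [hc4, Matrix.cons_val_zero, Matrix.cons_val_one, Matrix.cons_val, hgrA, h10A, h01A, starRingEnd_self_apply,
      h1, h1', h2] at hle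
    omega
  have hfinA : ∀ j, Module.finrank ℂ ↥(Module.End.eigenspace (φQ.baseChange ℂ) (c4 j)) = 2 := by
    intro j
    rw [hgrA, h10A, h01A]
    fin_cases j
    · show eigenMultiplicity A φA μ₁ + eigenMultiplicity A φA (starRingEnd ℂ μ₁) = 2; rw [h1, h1']
    · show eigenMultiplicity A φA (starRingEnd ℂ μ₁) + eigenMultiplicity A φA (starRingEnd ℂ (starRingEnd ℂ μ₁)) = 2
      rw [starRingEnd_self_apply, h1, h1']
    · show eigenMultiplicity A φA μ₂ + eigenMultiplicity A φA (starRingEnd ℂ μ₂) = 2; rw [h2, h2']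
    · show eigenMultiplicity A φA (starRingEnd ℂ μ₂) + eigenMultiplicity A φA (starRingEnd ℂ (starRingEnd ℂ μ₂)) = 2
      rw [starRingEnd_self_apply, h2, h2']
  have hWA : ∀ j, Module.End.eigenspace (φQ.baseChange ℂ) (c4 j) ≠ ⊥ := fun j hj => by
    have h := hfinA j; rw [hj, finrank_bot] at h; omega
  have hE := exists_eq_sum_smul_pow_bettiMapHom hHD hI φA hE4 c4 hc4inj hWA
  -- colours `μ = (μ₁, μ₂)`
  set μ : Fin 2 → ℂ := ![μ₁, μ₂] with hμ
  have hinj : Function.Injective μ := by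
    intro i j hij
    fin_cases i <;> fin_cases j
    all_goals simp [hμ] at hij
    all_goals first | rfl | exact absurd hij h12.symm | exact absurd hij h12
  have hdist : ∀ k k', μ k' ≠ starRingEnd ℂ (μ k) := by
    intro k k'
    fin_cases k <;> fin_cases k'
    · exact fun h => h11 (by simpa [hμ] using h.symm)
    · simpa [hμ] using h12'
    · intro h
      exact h12' (by simpa [hμ, starRingEnd_self_apply] using (congrArg (starRingEnd ℂ) h).symm)
    · exact fun h => h22 (by simpa [hμ] using h.symm)
  have hrank : ∀ k, Module.finrank ℂ ↥(Module.End.eigenspace (φQ.baseChange ℂ) (μ k) ⊓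
      (BettiUniverse.hodge hHD hXA 1).piece 1 0) +
      Module.finrank ℂ ↥(Module.End.eigenspace (φQ.baseChange ℂ) (μ k) ⊓
      (BettiUniverse.hodge hHD hXA 1).piece 0 1) = 2 := by
    intro k
    rw [h10A, h01A]
    fin_cases k
    · show eigenMultiplicity A φA μ₁ + eigenMultiplicity A φA (starRingEnd ℂ μ₁) = 2; rw [h1, h1']
    · show eigenMultiplicity A φA μ₂ + eigenMultiplicity A φA (starRingEnd ℂ μ₂) = 2; rw [h2, h2']
  have htop4 : (⨆ j, Module.End.eigenspace (φQ.baseChange ℂ) (c4 j)) = ⊤ := by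
    have hind : iSupIndep fun j => Module.End.eigenspace (φQ.baseChange ℂ) (c4 j) :=
      (Module.End.eigenspaces_iSupIndep (φQ.baseChange ℂ)).comp hc4inj
    apply Submodule.eq_top_of_finrank_eq
    have h := Motives.finrank_biSup_eq_sum_of_iSupIndep hind Finset.univ
    have hs : (⨆ j ∈ (Finset.univ : Finset (Fin 4)), Module.End.eigenspace (φQ.baseChange ℂ) (c4 j)) =
        ⨆ j, Module.End.eigenspace (φQ.baseChange ℂ) (c4 j) := by simp
    rw [hs] at h
    rw [h, hVCA, Finset.sum_congr rfl fun j _ => hfinA j, Finset.sum_const, Finset.card_univ, Fintype.card_fin,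
      smul_eq_mul]
  have htop : (⨆ kt : Fin 2 × Fin 2, Module.End.eigenspace (φQ.baseChange ℂ)
      (if kt.2 = 0 then μ kt.1 else starRingEnd ℂ (μ kt.1))) = ⊤ := by
    rw [eq_top_iff, ← htop4]
    refine iSup_le fun j => ?_
    fin_cases j
    · exact le_iSup_of_le ((0 : Fin 2), (0 : Fin 2)) (by simp [hc4, hμ])
    · exact le_iSup_of_le ((0 : Fin 2), (1 : Fin 2)) (by simp [hc4, hμ])
    · exact le_iSup_of_le ((1 : Fin 2), (0 : Fin 2)) (by simp [hc4, hμ])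
    · exact le_iSup_of_le ((1 : Fin 2), (1 : Fin 2)) (by simp [hc4, hμ])
  -- the rational plane `𝔷₁ = E⁻` of `ψ`-skew Hodge endomorphisms of `H¹(A)`; (Z1); (ND₁)
  obtain ⟨𝔷₁, h𝔷₁⟩ : ∃ Z : Submodule ℚ (Module.End ℚ (bettiCohomology A.X 1)), ∀ a, a ∈ Z ↔
      a ∈ (BettiUniverse.hodge hHD hXA 1).endAlg ∧ ∀ v w, ψ.form (a v) w + ψ.form v (a w) = 0 :=
    ⟨{ carrier := {a | a ∈ (BettiUniverse.hodge hHD hXA 1).endAlg ∧ ∀ v w, ψ.form (a v) w + ψ.form v (a w) = 0}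
       add_mem' := fun {a b} ha hb => ⟨Subalgebra.add_mem _ ha.1 hb.1, fun v w => by
         rw [LinearMap.add_apply, LinearMap.add_apply, map_add, map_add, LinearMap.add_apply]
         linear_combination ha.2 v w + hb.2 v w⟩
       zero_mem' := ⟨Subalgebra.zero_mem _, fun v w => by simp⟩
       smul_mem' := fun r a ha => ⟨Subalgebra.smul_mem _ ha.1 r, fun v w => by
         rw [LinearMap.smul_apply, LinearMap.smul_apply, map_smul, map_smul, LinearMap.smul_apply, smul_eq_mul,
           smul_eq_mul, ← mul_add, ha.2, mul_zero]⟩ }, fun a => Iff.rfl⟩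
  have hZ₁ : ∀ a ∈ (BettiUniverse.hodge hHD hXA 1).endAlg, (∀ b ∈ (BettiUniverse.hodge hHD hXA 1).endAlg, a * b = b * a) →
      (∀ v w, ψ.form (a v) w + ψ.form v (a w) = 0) → a ∈ 𝔷₁ := fun a ha _ hs => (h𝔷₁ a).2 ⟨ha, hs⟩
  have h𝔷₁E : ∀ a ∈ 𝔷₁, a ∈ (BettiUniverse.hodge hHD hXA 1).endAlg := fun a ha => ((h𝔷₁ a).1 ha).1
  have h𝔷₁skew : ∀ a ∈ 𝔷₁, ∀ v w, ψ.form (a v) w + ψ.form v (a w) = 0 := fun a ha => ((h𝔷₁ a).1 ha).2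
  have hND₁ : ∀ ℓ : Module.End ℚ (bettiCohomology A.X 1) →ₗ[ℚ] ℚ, ∃ a ∈ 𝔷₁, ∀ x ∈ 𝔷₁,
      ℓ x = LinearMap.trace ℚ _ (a * x) :=
    fun ℓ => exists_trace_representative_of_skew (BettiUniverse.hodge hHD hXA 1) ψ 𝔷₁ h𝔷₁E h𝔷₁skew ℓ
  -- the `C`-side hypotheses of the Lie step
  have hfamE : ∀ e : K, (Acm.ι e : Module.End ℚ (bettiCohomology C.X 1)) ∈ (BettiUniverse.hodge hHD hXC 1).endAlg :=
    fun e => (Acm.hom e).toLinearMap_mem_endAlg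
  have h𝔲c : ∀ Y ∈ 𝔲, ∀ Y' ∈ 𝔲, Y * Y' = Y' * Y := fun Y hY Y' hY' => Acm.commute_of_mem_map S hY hY'
  have h𝔲skew : ∀ Y ∈ 𝔲, ∀ v w, ψC.form (Y v) w + ψC.form v (Y w) = 0 :=
    fun Y hY v w => Acm.form_add_eq_zero_of_mem_map S hS hcompat hY v w
  have hcommC : ∀ Y : Module.End ℂ (ℂ ⊗[ℚ] bettiCohomology C.X 1),
      (∀ e : K, Y * (Acm.ι e).baseChange ℂ = (Acm.ι e).baseChange ℂ * Y) →
      (∀ x' y', ψC.form.baseChange ℂ (Y x') y' + ψC.form.baseChange ℂ x' (Y y') = 0) → Y ∈ spanC 𝔲 :=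
    fun Y hYc hYs => Acm.mem_spanC_map_of_commute_of_skew S hS hline ψC hcompat hYc hYs
  have h𝔲E : ∀ Y ∈ 𝔲, Y ∈ (BettiUniverse.hodge hHD hXC 1).endAlg := by
    intro Y hY
    obtain ⟨z, -, rfl⟩ := Submodule.mem_map.1 hY
    exact hfamE z
  have hND₂ : ∀ ℓ : Module.End ℚ (bettiCohomology C.X 1) →ₗ[ℚ] ℚ, ∃ b ∈ 𝔲, ∀ y ∈ 𝔲,
      ℓ y = LinearMap.trace ℚ _ (b * y) :=
    fun ℓ => exists_trace_representative_of_skew (BettiUniverse.hodge hHD hXC 1) ψC 𝔲 h𝔲E h𝔲skew ℓ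
  -- (NA): `Tr(a_ℂ Θ_A) + Tr(b_ℂ Θ_C) = 4 σ_{μ₂}(a) + 2 tr_Φ(z) = 0` forces `a = 0` and `z = 0`
  have hΘAC : ΘA ∈ (BettiUniverse.hodge hHD hXA 1).hodgeLieC := (BettiUniverse.hodge hHD hXA 1).mem_hodgeLieC_of_forall_piece hΘA
  have hΘAφ : ΘA * φQ.baseChange ℂ = φQ.baseChange ℂ * ΘA :=
    commute_baseChange_of_mem_hodgeLieC (BettiUniverse.hodge hHD hXA 1) hΘAC ⟨φQ, hφE⟩
  have hΘAskew : ∀ x y, ψ.form.baseChange ℂ (ΘA x) y + ψ.form.baseChange ℂ x (ΘA y) = 0 := fun x y => by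
    rw [formBaseChange_skew_of_mem_hodgeLieC ψ hΘAC, neg_add_cancel]
  -- `Θ_C` on the eigenbasis `cC`
  have hΘCc : ∀ (i : Fin 2) (r : Fin 2), ΘC (cC (i, r)) = (if r = 0 then (1 : ℂ) else -1) • cC (i, r) := by
    intro i r
    rcases fin2_eq_zero_or_one_cs r with h0 | h1
    · rw [h0, if_pos rfl]
      have hmem : cC (i, 0) ∈ (BettiUniverse.hodge hHD hXC 1).piece 1 (((1 : ℕ) : ℤ) - 1) := by
        have e : (((1 : ℕ) : ℤ) - 1) = 0 := by norm_num
        rw [e]; exact hcC0' i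
      rw [hΘC 1 _ hmem]
      norm_num
    · rw [h1, if_neg one_ne_zero]
      have hmem : cC (i, 1) ∈ (BettiUniverse.hodge hHD hXC 1).piece 0 (((1 : ℕ) : ℤ) - 0) := by
        have e : (((1 : ℕ) : ℤ) - 0) = 1 := by norm_num
        rw [e]; exact hcC1' i
      rw [hΘC 0 _ hmem]
      norm_num
  have hNA' : ∀ a ∈ 𝔷₁, ∀ b ∈ 𝔲,
      LinearMap.trace ℂ _ (a.baseChange ℂ * ΘA) + LinearMap.trace ℂ _ (b.baseChange ℂ * ΘC) = 0 →
        (∀ x ∈ 𝔷₁, LinearMap.trace ℚ _ (a * x) = 0) ∧ (∀ y ∈ 𝔲, LinearMap.trace ℚ _ (b * y) = 0) := by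
    intro a ha b hb hsum
    have haE := h𝔷₁E a ha
    have haskew := h𝔷₁skew a ha
    obtain ⟨z, hzS, rfl⟩ := Submodule.mem_map.1 hb
    simp only [AlgHom.toLinearMap_apply] at hsum ⊢
    have hzs : IsCMField.complexConj K z = -z := (hS z).1 hzS
    -- the scalars `P(c) = Σ q_k c^k` of `a = Σ q_k φQ^k` on the eigenspaces of `φQ`
    obtain ⟨qa, hqa⟩ := hE a haE
    have hσP : ∀ (cc : ℂ), ∀ w ∈ Module.End.eigenspace (φQ.baseChange ℂ) cc,
        a.baseChange ℂ w = (∑ k, (qa k : ℂ) * cc ^ (k : ℕ)) • w := by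
      intro cc w hw
      rw [hqa, Finset.sum_smul]
      have h : ∀ s : Finset (Fin 4), (∑ k ∈ s, qa k • φQ ^ (k : ℕ)).baseChange ℂ w =
          ∑ k ∈ s, ((qa k : ℂ) * cc ^ (k : ℕ)) • w := by
        intro s
        induction s using Finset.induction_on with
        | empty => rw [Finset.sum_empty, Finset.sum_empty, LinearMap.baseChange_zero, LinearMap.zero_apply]
        | insert k s hk ih =>
          rw [Finset.sum_insert hk, Finset.sum_insert hk, LinearMap.baseChange_add, LinearMap.add_apply, ih,
            LinearMap.baseChange_smul, LinearMap.smul_apply, QuarticTheta.baseChange_pow_apply φQ hw,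
            ← algebraMap_smul ℂ (qa k) (cc ^ (k : ℕ) • w), smul_smul, eq_ratCast]
      exact h Finset.univ
    set w₂ : ℂ := ∑ k, (qa k : ℂ) * μ₂ ^ (k : ℕ) with hw₂
    -- `Tr(a_ℂ Θ_A) = 4 P(μ₂)`
    have htrA : LinearMap.trace ℂ _ (a.baseChange ℂ * ΘA) = 4 * w₂ := by
      rw [CMThetaCentre.trace_baseChange_mul_theta (BettiUniverse.hodge hHD hXA 1) hn1 heffA ψ hφE hE μ hinj hdist hrank
        htop hΘA hΘAφ hΘAskew haskew (fun k => ∑ j, (qa j : ℂ) * μ k ^ (j : ℕ)) (fun k w hw => hσP (μ k) w hw),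
        Fin.sum_univ_two, h10A, h01A, h10A, h01A]
      simp only [hμ, Matrix.cons_val_zero, Matrix.cons_val_one, Matrix.cons_val_fin_one, h1, h1', h2, h2', hw₂]
      push_cast
      ring
    -- `Tr(b_ℂ Θ_C) = 2 tr_Φ(z) = 2 (x z + y z)`
    have hdiagC : ∀ ir : Fin 2 × Fin 2, ((Acm.ι z : Module.End ℚ (bettiCohomology C.X 1)).baseChange ℂ * ΘC) (cC ir) =
        ((if ir.2 = 0 then (1 : ℂ) else -1) * (emb ir) z) • cC ir := by
      rintro ⟨i, r⟩
      rw [Module.End.mul_apply, hΘCc, map_smul, hcCev, smul_smul]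
    have htrC : LinearMap.trace ℂ _ ((Acm.ι z : Module.End ℚ (bettiCohomology C.X 1)).baseChange ℂ * ΘC) =
        2 * (x z + y z) := by
      rw [trace_eq_sum_of_apply_basis_eq_smul cC _ _ hdiagC, Fintype.sum_prod_type, Fin.sum_univ_two, Fin.sum_univ_two,
        Fin.sum_univ_two]
      simp only [if_true, if_neg (one_ne_zero : (1 : Fin 2) ≠ 0), hemb0eq, hemb1eq,
        QuarticCM.conjugate_apply_eq_neg_of_skew _ hzs, he0, Matrix.cons_val_zero, Matrix.cons_val_one,
        Matrix.cons_val_fin_one]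
      ring
    rw [htrA, htrC] at hsum
    -- `t = x z + y z = tr_Φ(z)` is purely imaginary and lies in the reflex field `K*_Φ`; `w₂ = -t/2 ∈ ℚ(μ₂)`
    have htconj : starRingEnd ℂ (x z + y z) = -(x z + y z) := by
      rw [map_add, ← ComplexEmbedding.conjugate_coe_eq x z, ← ComplexEmbedding.conjugate_coe_eq y z,
        QuarticCM.conjugate_apply_eq_neg_of_skew x hzs, QuarticCM.conjugate_apply_eq_neg_of_skew y hzs, neg_add]
    have htrace : cmTypeTrace Φ z = x z + y z := cmTypeTrace_eq_add hK4 Φ hx (by rw [hΦ]; exact Or.inr rfl) hyx.symm z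
    have hw₂t : w₂ = -(1 / 2 : ℂ) * (x z + y z) := by linear_combination (1 / 4 : ℂ) * hsum
    have hw₂K : w₂ ∈ traceField Φ := by
      rw [hw₂t]
      refine mul_mem ?_ (by rw [← htrace]; exact cmTypeTrace_mem_traceField Φ z)
      have h : (-(1 / 2 : ℂ)) = algebraMap ℚ ℂ (-(1 / 2 : ℚ)) := by rw [map_neg, map_div₀, map_one, map_ofNat]
      rw [h]; exact IntermediateField.algebraMap_mem _ _
    have hw₂E : w₂ ∈ IntermediateField.adjoin ℚ {μ₂} := by
      rw [hw₂]
      refine IntermediateField.sum_mem _ fun k _ => mul_mem ?_ (pow_mem (IntermediateField.mem_adjoin_simple_self ℚ μ₂) _)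
      have hq : ((qa k : ℚ) : ℂ) = algebraMap ℚ ℂ (qa k) := (eq_ratCast _ _).symm
      rw [hq]
      exact IntermediateField.algebraMap_mem _ _
    have hw₂conj : starRingEnd ℂ w₂ = -w₂ := by
      rw [hw₂t, map_mul, htconj, map_neg, map_div₀, map_one, map_ofNat]
      ring
    have hw₂0 : w₂ = 0 := hNA w₂ hw₂E hw₂K hw₂conj
    have ht0 : x z + y z = 0 := by
      have h : (4 : ℂ) * w₂ + 2 * (x z + y z) = 0 := hsum
      rw [hw₂0, mul_zero, zero_add] at h
      exact (mul_eq_zero.1 h).resolve_left two_ne_zero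
    -- `z = 0` (a non-zero skew `z` of the quartic CM field `K` has `x z + y z ≠ 0`)
    have hz0 : z = 0 := by
      by_contra hz0
      have h := QuarticCM.ratCast_mul_apply_add_ne_zero_of_skew hK4 hyx hyx' hz0 hzs (hnosqK z hzs hz0)
        (m₁ := 1) (m₂ := 1) (Or.inl one_ne_zero)
      rw [Rat.cast_one, one_mul, one_mul] at h
      exact h ht0
    -- `a = 0` (`a` acts by `P(μ₂) = 0` on `W_{μ₂} ≠ 0` and is invertible in the field `E = End_Hdg` unless zero)
    have ha0 : a = 0 := by
      by_contra ha0
      obtain ⟨a', ha'⟩ := exists_mul_eq_one_of_mem_endAlg_of_isSimple hHD hI hAs a haE ha0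
      obtain ⟨w, hw, hw0⟩ := (Submodule.ne_bot_iff _).1 (hWA 2)
      have hw' : w ∈ Module.End.eigenspace (φQ.baseChange ℂ) μ₂ := by simpa [hc4] using hw
      have haw : a.baseChange ℂ w = 0 := by rw [hσP μ₂ w hw', ← hw₂, hw₂0, zero_smul]
      have h := congrArg (fun f : Module.End ℚ (bettiCohomology A.X 1) => f.baseChange ℂ w) ha'
      simp only [LinearMap.baseChange_mul, Module.End.mul_apply, haw, map_zero, LinearMap.baseChange_one,
        Module.End.one_apply] at h
      exact hw0 h.symm
    refine ⟨fun x' _ => by rw [ha0, zero_mul, map_zero], fun y' _ => by rw [hz0, map_zero, zero_mul, map_zero]⟩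
  -- the product Lie step: `Y` kills the rational coefficient tensor
  have hL : ∀ u : Fin (2 * p) → Fin n, wordDerAt ℂ (fun _ : Fin (2 * p) => LinearMap.toMatrix eC eC Y)
      (wordSlice (fun w => algebraMap ℚ ℂ (q' w)) u) = 0 := fun u =>
    wordDerAt_incl_theta_proj_eq_zero_of_centre_times_torus_of_traceNonAligned hn1 (BettiUniverse.hodge hHD hXP 1)
      (BettiUniverse.hodge hHD hXA 1) (BettiUniverse.hodge hHD hXC 1) heffA
      hπι₁ hπι₂ hπ₁ι₂ hπ₂ι₁ hsum hι₁F hι₂F ψ ψC 𝔷₁ 𝔷₁ hZ₁ h𝔷₁E hND₁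
      (fun e : K => (Acm.ι e : Module.End ℚ (bettiCohomology C.X 1))) hfamE 𝔲 𝔲 h𝔲c hcommC hND₂
      hΘ hΘA hΘC hNA' eQ q' hΘq u
  -- the diagonal weights of `Y` in the pair letters: `±1` at the `A`-places, `0` at the `C`-places
  set δ₀ : Fin hA ⊕ Fin 2 → Fin 2 → ℂ :=
    Sum.elim (fun (_ : Fin hA) (r : Fin 2) => if r = 0 then (1 : ℂ) else -1) (fun (_ : Fin 2) (_ : Fin 2) => (0 : ℂ))
    with hδ₀
  set D : Fin hA ⊕ Fin 2 → Matrix (Fin 2) (Fin 2) ℂ := fun t => Matrix.diagonal (δ₀ t) with hD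
  have hYG : ∀ _t : Fin (2 * p), LinearMap.toMatrix eC eC Y * G = G * LinearMap.toMatrix cbσ cbσ Y :=
    fun _ => by rw [hG, linearMap_toMatrix_mul_basis_toMatrix, basis_toMatrix_mul_linearMap_toMatrix]
  have e11 : ∀ x, π₁.baseChange ℂ (ι₁.baseChange ℂ x) = x := fun x => by
    rw [← LinearMap.comp_apply (f := π₁.baseChange ℂ), hπι₁C, LinearMap.id_apply]
  have e12 : ∀ y, π₁.baseChange ℂ (ι₂.baseChange ℂ y) = 0 := fun y => by
    rw [← LinearMap.comp_apply (f := π₁.baseChange ℂ), hπ₁ι₂C, LinearMap.zero_apply]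
  -- `Θ_A` on the pair basis of `H¹(A) ⊗ ℂ`
  have hΘAb : ∀ (i : Fin hA) (r : Fin 2), ΘA (bA (i, r)) = (if r = 0 then (1 : ℂ) else -1) • bA (i, r) := by
    intro i r
    rcases fin2_eq_zero_or_one_cs r with h0 | h1
    · rw [h0, if_pos rfl]
      have hmem : bA (i, 0) ∈ (BettiUniverse.hodge hHD hXA 1).piece 1 (((1 : ℕ) : ℤ) - 1) := by
        have e : (((1 : ℕ) : ℤ) - 1) = 0 := by norm_num
        rw [e]; exact hbA0' i
      rw [hΘA 1 _ hmem]
      norm_num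
    · rw [h1, if_neg one_ne_zero]
      have hmem : bA (i, 1) ∈ (BettiUniverse.hodge hHD hXA 1).piece 0 (((1 : ℕ) : ℤ) - 0) := by
        have e : (((1 : ℕ) : ℤ) - 0) = 1 := by norm_num
        rw [e]; exact hbA1' i
      rw [hΘA 0 _ hmem]
      norm_num
  have hblk : LinearMap.toMatrix cbσ cbσ Y = blockLift φ D := by
    refine toMatrix_eq_blockLift_of_apply_basis φ cbσ _ Y fun m => ?_
    rw [hcbσ m]
    have hb' : ∀ a, cbσ (φ.symm ((φ m).1, a)) = cbx ((φ m).1, a) := fun a => by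
      rw [hcbσ, Equiv.apply_symm_apply]
    simp only [hb']
    obtain ⟨t, r⟩ := φ m
    rcases t with i | i
    · simp only [hcbx, Sum.elim_inl]
      rw [hY, LinearMap.comp_apply, LinearMap.comp_apply, e11, hΘAb, map_smul,
        Finset.sum_eq_single r]
      · rw [hD]
        simp only [hδ₀, Sum.elim_inl, Matrix.diagonal_apply_eq]
      · intro a _ ha
        rw [hD]
        simp only [Matrix.diagonal_apply_ne _ ha, zero_smul]
      · intro hr; exact absurd (Finset.mem_univ r) hr
    · simp only [hcbx, Sum.elim_inr]
      rw [hY, LinearMap.comp_apply, LinearMap.comp_apply, e12, map_zero, map_zero]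
      symm
      refine Finset.sum_eq_zero fun a _ => ?_
      have h0 : D (Sum.inr i) a r = 0 := by
        simp [hD, hδ₀, Matrix.diagonal_apply]
      rw [h0, zero_smul]
  -- `Y` kills the coefficient tensor in the pair letters
  have hax : ∀ u : Fin (2 * p) → Fin n, wordDerAt ℂ (fun _ : Fin (2 * p) => blockLift φ D) (wordSlice ax u) = 0 := by
    intro u
    have hLu := hL u
    rw [← haEq, hslice_e] at hLu
    have h3 : wordRepAt ℂ (fun _ : Fin (2 * p) => G)
        (wordDerAt ℂ (fun _ : Fin (2 * p) => blockLift φ D) (wordSlice ax u)) = 0 := by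
      rw [← hblk, wordRepAt_wordDerAt_of_mul_eq ℂ (fun _ : Fin (2 * p) => G) hYG, hLu]
    exact wordRepAt_injective ℂ (g := fun _ : Fin (2 * p) => G) (g' := fun _ : Fin (2 * p) => G')
      (funext fun _ => hG'G) (by rw [h3, map_zero])
  -- the coefficient function, refined to slot-and-place colours
  refine ⟨placeRefine φ ax, ?_, fun U η hU => ?_⟩
  · rw [← hcax]
    have hx : (fun jr : (Fin n × (Fin hA ⊕ Fin 2)) × Fin 2 => avLetters g v (jr.1.1, φ.symm (jr.1.2, jr.2))) =
        fun jr : (Fin n × (Fin hA ⊕ Fin 2)) × Fin 2 => complexBetti.map (g jr.1.1).hom.hom.hom 1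
          (Sum.elim
            (fun i => complexBetti.map (Motives.AbelianVariety.fst A C).hom.hom.hom 1
              (ofRatClassBaseChange (Motives.ComplexPoints A.X) 1 (bA (i, jr.2))))
            (fun i => complexBetti.map (Motives.AbelianVariety.snd A C).hom.hom.hom 1
              (ofRatClassBaseChange (Motives.ComplexPoints C.X) 1 (cC (i, jr.2))))
            jr.1.2) := by
      funext jr
      rw [avLetters_apply, hv_apply, Equiv.apply_symm_apply, hcbx]
      obtain ⟨⟨j, t⟩, r⟩ := jr
      rcases t with i | i
      · simp only [Sum.elim_inl]
        congr 1
        rw [hι₁, ← ofRatClassBaseChangeEquiv_apply (hX := hXP), ← ofRatClassBaseChangeEquiv_apply (hX := hXA),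
          complexBetti_map_ofRatClassBaseChangeEquiv hXP hXA]
      · simp only [Sum.elim_inr]
        congr 1
        rw [hι₂, ← ofRatClassBaseChangeEquiv_apply (hX := hXP), ← ofRatClassBaseChangeEquiv_apply (hX := hXC),
          complexBetti_map_ofRatClassBaseChangeEquiv hXP hXC]
    rw [← hx]
    exact wordEval_placeRefine _ φ (avLetters g v) ax
  · -- the blocks of `Y` placed by place kill the refined slices; read off the diagonal weights
    have h1 := wordDerAt_placeFamily_placeRefine_eq_zero φ D hax U
    have h2 : wordDerAt ℂ (fun t => Matrix.diagonal (δ₀ (U t).2)) (wordSlice (placeRefine φ ax) U) = 0 := h1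
    have h3 := eq_zero_of_wordDerAt_diagonal_eq_zero (fun t => δ₀ (U t).2) h2 η (by
      have hsum_eq : ∑ t, δ₀ (U t).2 (η t) =
          ∑ t, Sum.elim (fun _ : Fin hA => if η t = 0 then (1 : ℂ) else -1) (fun _ : Fin 2 => (0 : ℂ)) (U t).2 := by
        refine Finset.sum_congr rfl fun t _ => ?_
        rw [hδ₀]
        exact sum_elim_kindWeight_apply (U t).2 (η t)
      rw [hsum_eq]; exact hU)
    rw [wordSlice_apply] at h3
    exact h3



end Invariance

/-! ### §2 The product span for `Y × S` (quartic CM centre, simple CM surface, non-aligned) -/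

section ProductSpanOpens

open MonoidalCategory CartesianMonoidalCategory

section ProductSpan

variable {A B C Z : AbelianVariety ℂ} {n : ℕ} {gB : Fin n → (B ⟶ A)} {gC : Fin n → (Z ⟶ C)}

/-- **`HodgeClassesProductSpan B Z` for slots over `Y × S`** (`Y = A` simple with quartic CM centre of signature
`{(2,0),(1,1)}`, `S = C` a simple CM surface of type `(K, Φ)`, NON-ALIGNED (hNA); `B` with `n` slots over `A`, `Z` with `n`
slots over `C`, e.g. `B = A^{N+1}`, `Z = C^{N+1}`): every rational class of Hodge type `(p,p)` on `B × Z` is a `ℂ`-combination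
of exterior products of RATIONAL HODGE classes — R28b's §2 verbatim, fed by §1 (Moonen–Zarhin (3.1): «`𝔤₃ ≠ 0` … if and only
if for some `m` and `n` the Hodge ring `B(X₁^m × X₂^n)` is not generated by the elements coming from `B(X₁^m)` and `B(X₂^n)`»).
[cite: MoonenZarhin1999LowDim, §3 (3.1) and Lemma (3.6)] [cite: Lombardo2016, Lemma 3.4 (p. 1229)] -/
theorem hodgeClassesProductSpan_of_avSlots_of_quarticCentre_simpleCMSurface
    (hAs : A.IsSimple) (φA : A ⟶ A) (hE4 : Module.finrank ℚ A.endAlgebra = 4) {μ₁ μ₂ : ℂ}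
    (h11 : starRingEnd ℂ μ₁ ≠ μ₁) (h22 : starRingEnd ℂ μ₂ ≠ μ₂) (h12 : μ₂ ≠ μ₁) (h12' : μ₂ ≠ starRingEnd ℂ μ₁)
    (h1 : eigenMultiplicity A φA μ₁ = 1) (h1' : eigenMultiplicity A φA (starRingEnd ℂ μ₁) = 1)
    (h2 : eigenMultiplicity A φA μ₂ = 2) (hdim : A.dim = 4)
    {K : Type} [Field K] [NumberField K] [IsCMField K] {Φ : CMType K} {ιC : 𝓞 K →+* End C}
    {θ : K →+* Module.End ℂ (complexBetti C.X 1)} (hreal : IsCMTypeRealisation Φ C ιC θ)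
    (hK4 : Module.finrank ℚ K = 4) (hCs : C.IsSimple)
    (hNA : ∀ w : ℂ, w ∈ IntermediateField.adjoin ℚ {μ₂} → w ∈ traceField Φ → starRingEnd ℂ w = -w → w = 0)
    (hgB : AVSlots A B gB) (hgC : AVSlots C Z gC) :
    HodgeClassesProductSpan B Z := by
  classical
  intro p c hcQ hc
  have hB : IsSmoothProjective B.dim B.X := Motives.AbelianVariety.isSmoothProjective_holds
  have hZ : IsSmoothProjective Z.dim Z.X := Motives.AbelianVariety.isSmoothProjective_holds
  have hXA : IsSmoothProjective A.dim A.X := Motives.AbelianVariety.isSmoothProjective_holds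
  have hXC : IsSmoothProjective C.dim C.X := Motives.AbelianVariety.isSmoothProjective_holds
  obtain ⟨hA, bA, cC, hbA0, hbA1, hcC0, hcC1, hmain⟩ :=
    (hgB.prodLift hgC).exists_coeff_eq_zero_off_balanced_of_prod_quarticCentre_simpleCMSurface hAs φA hE4 h11 h22 h12 h12'
      h1 h1' h2 hdim hreal hK4 hCs hNA
  have hc' : IsOfHodgeType (B.prod Z).dim (B.prod Z).X (2 * p) p p c := by
    rw [Motives.AbelianVariety.dim_prod]; exact hc
  rcases Nat.eq_zero_or_pos p with rfl | hp
  · -- degree `0`: `c = s · 1 = pr_B^*(s · 1_B) ⌣ pr_Z^* 1_Z`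
    have h1 : c ∈ Submodule.span ℂ {singularCohomology.one ℂ (ComplexPoints (B.X ⊗ Z.X))} :=
      mem_divisorClassesSpan_zero (N := B.dim + Z.dim) (IsSmoothProjective.tensor_holds hB hZ) c
    obtain ⟨s, hs⟩ := Submodule.mem_span_singleton.1 h1
    refine mem_span_hodgeProductClasses_of_mem_span_pureType B Z hcQ hc (Submodule.subset_span ?_)
    refine ⟨0, 0, rfl, s • singularCohomology.one ℂ (ComplexPoints B.X), singularCohomology.one ℂ (ComplexPoints Z.X),
      ⟨0, rfl, isOfHodgeType_zero_zero_of_degree_zero hB _⟩,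
      ⟨0, 0, rfl, isOfHodgeType_zero_zero_of_degree_zero hZ _⟩, ?_⟩
    rw [← hs, map_smul, LinearMap.map_smul₂]
    erw [singularCohomology.map_one, singularCohomology.map_one, cupProduct_one]
  · obtain ⟨a, hca, hkill⟩ := hmain hp hcQ hc'
    -- the letters of `B × Z` over `A × C` are `pr_B^*`(letters of `B` over `A`) and `pr_Z^*`(letters of `Z` over `C`)
    set xA : (Fin n × Fin hA) × Fin 2 → complexBetti B.X 1 := fun jr =>
      complexBetti.map (gB jr.1.1).hom.hom.hom 1 (ofRatClassBaseChange (ComplexPoints A.X) 1 (bA (jr.1.2, jr.2)))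
      with hxA
    set y : (Fin n × Fin 2) × Fin 2 → complexBetti Z.X 1 := fun jr =>
      complexBetti.map (gC jr.1.1).hom.hom.hom 1 (ofRatClassBaseChange (ComplexPoints C.X) 1 (cC (jr.1.2, jr.2)))
      with hy
    have hletters : (fun jr : (Fin n × (Fin hA ⊕ Fin 2)) × Fin 2 => complexBetti.map
        (Motives.AbelianVariety.prodLift (Motives.AbelianVariety.fst B Z ≫ gB jr.1.1)
          (Motives.AbelianVariety.snd B Z ≫ gC jr.1.1)).hom.hom.hom 1
        (Sum.elim
          (fun i => complexBetti.map (Motives.AbelianVariety.fst A C).hom.hom.hom 1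
            (ofRatClassBaseChange (ComplexPoints A.X) 1 (bA (i, jr.2))))
          (fun i => complexBetti.map (Motives.AbelianVariety.snd A C).hom.hom.hom 1
            (ofRatClassBaseChange (ComplexPoints C.X) 1 (cC (i, jr.2))))
          jr.1.2)) =
        fun jr : (Fin n × (Fin hA ⊕ Fin 2)) × Fin 2 => Sum.elim
          (fun i => complexBetti.map (Motives.AbelianVariety.fst B Z).hom.hom.hom 1 (xA ((jr.1.1, i), jr.2)))
          (fun i => complexBetti.map (Motives.AbelianVariety.snd B Z).hom.hom.hom 1 (y ((jr.1.1, i), jr.2)))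
          jr.1.2 := by
      funext jr
      obtain ⟨⟨j, t⟩, κ⟩ := jr
      rcases t with i | i
      · simp only [Sum.elim_inl, hxA]
        rw [complexBetti_map_map_hom, complexBetti_map_map_hom, Motives.AbelianVariety.prodLift_fst]
      · simp only [Sum.elim_inr, hy]
        rw [complexBetti_map_map_hom, complexBetti_map_map_hom, Motives.AbelianVariety.prodLift_snd]
    -- types of the letters
    have hxA0 : ∀ jr : (Fin n × Fin hA) × Fin 2, jr.2 = 0 → IsOfHodgeType B.dim B.X 1 1 0 (xA jr) := by
      rintro ⟨⟨j, i⟩, κ⟩ hκ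
      change κ = 0 at hκ
      subst hκ
      exact (hbA0 i).map_of_isSmoothProjective hB hXA _
    have hxA1 : ∀ jr : (Fin n × Fin hA) × Fin 2, jr.2 = 1 → IsOfHodgeType B.dim B.X 1 0 1 (xA jr) := by
      rintro ⟨⟨j, i⟩, κ⟩ hκ
      change κ = 1 at hκ
      subst hκ
      exact (hbA1 i).map_of_isSmoothProjective hB hXA _
    have hy0 : ∀ jr : (Fin n × Fin 2) × Fin 2, jr.2 = 0 → IsOfHodgeType Z.dim Z.X 1 1 0 (y jr) := by
      rintro ⟨⟨j, i⟩, κ⟩ hκ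
      change κ = 0 at hκ
      subst hκ
      exact (hcC0 i).map_of_isSmoothProjective hZ hXC _
    have hy1 : ∀ jr : (Fin n × Fin 2) × Fin 2, jr.2 = 1 → IsOfHodgeType Z.dim Z.X 1 0 1 (y jr) := by
      rintro ⟨⟨j, i⟩, κ⟩ hκ
      change κ = 1 at hκ
      subst hκ
      exact (hcC1 i).map_of_isSmoothProjective hZ hXC _
    -- evaluate and feed the typed criterion
    have hmem := wordEval_mem_span_typed_cup_pureType_of_eq_zero_off_balanced
      (Motives.AbelianVariety.fst B Z) (Motives.AbelianVariety.snd B Z) xA y hxA0 hxA1 hy0 hy1 hkill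
    rw [← hletters, hca] at hmem
    refine mem_span_hodgeProductClasses_of_mem_span_pureType B Z hcQ hc (Submodule.span_mono ?_ hmem)
    rintro z ⟨i, j, hij, d, μ, hd, hμ, rfl⟩
    exact ⟨i, j, hij, d, μ, hd, hμ, rfl⟩

/-- **Equal powers**: `HodgeClassesProductSpan (Y^{N+1}) (S^{N+1})` for a non-aligned pair (slots `AVSlots.powSucc`).
[cite: MoonenZarhin1999LowDim, §3 (3.1) and Lemma (3.6)] [cite: Lombardo2016, Lemma 3.4 (p. 1229)] -/
theorem hodgeClassesProductSpan_powSucc_powSucc_of_quarticCentre_simpleCMSurface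
    (hAs : A.IsSimple) (φA : A ⟶ A) (hE4 : Module.finrank ℚ A.endAlgebra = 4) {μ₁ μ₂ : ℂ}
    (h11 : starRingEnd ℂ μ₁ ≠ μ₁) (h22 : starRingEnd ℂ μ₂ ≠ μ₂) (h12 : μ₂ ≠ μ₁) (h12' : μ₂ ≠ starRingEnd ℂ μ₁)
    (h1 : eigenMultiplicity A φA μ₁ = 1) (h1' : eigenMultiplicity A φA (starRingEnd ℂ μ₁) = 1)
    (h2 : eigenMultiplicity A φA μ₂ = 2) (hdim : A.dim = 4)
    {K : Type} [Field K] [NumberField K] [IsCMField K] {Φ : CMType K} {ιC : 𝓞 K →+* End C}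
    {θ : K →+* Module.End ℂ (complexBetti C.X 1)} (hreal : IsCMTypeRealisation Φ C ιC θ)
    (hK4 : Module.finrank ℚ K = 4) (hCs : C.IsSimple)
    (hNA : ∀ w : ℂ, w ∈ IntermediateField.adjoin ℚ {μ₂} → w ∈ traceField Φ → starRingEnd ℂ w = -w → w = 0)
    (N : ℕ) : HodgeClassesProductSpan (A.powSucc N) (C.powSucc N) :=
  hodgeClassesProductSpan_of_avSlots_of_quarticCentre_simpleCMSurface hAs φA hE4 h11 h22 h12 h12' h1 h1' h2 hdim hreal
    hK4 hCs hNA (AVSlots.powSucc A N) (AVSlots.powSucc C N)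

/-- One slot on each side: `HodgeClassesProductSpan Y S` for a non-aligned pair. [cite: MoonenZarhin1999LowDim, §3 (3.1) and Lemma (3.6)] -/
theorem hodgeClassesProductSpan_of_quarticCentre_simpleCMSurface
    (hAs : A.IsSimple) (φA : A ⟶ A) (hE4 : Module.finrank ℚ A.endAlgebra = 4) {μ₁ μ₂ : ℂ}
    (h11 : starRingEnd ℂ μ₁ ≠ μ₁) (h22 : starRingEnd ℂ μ₂ ≠ μ₂) (h12 : μ₂ ≠ μ₁) (h12' : μ₂ ≠ starRingEnd ℂ μ₁)
    (h1 : eigenMultiplicity A φA μ₁ = 1) (h1' : eigenMultiplicity A φA (starRingEnd ℂ μ₁) = 1)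
    (h2 : eigenMultiplicity A φA μ₂ = 2) (hdim : A.dim = 4)
    {K : Type} [Field K] [NumberField K] [IsCMField K] {Φ : CMType K} {ιC : 𝓞 K →+* End C}
    {θ : K →+* Module.End ℂ (complexBetti C.X 1)} (hreal : IsCMTypeRealisation Φ C ιC θ)
    (hK4 : Module.finrank ℚ K = 4) (hCs : C.IsSimple)
    (hNA : ∀ w : ℂ, w ∈ IntermediateField.adjoin ℚ {μ₂} → w ∈ traceField Φ → starRingEnd ℂ w = -w → w = 0) :
    HodgeClassesProductSpan A C :=
  hodgeClassesProductSpan_of_avSlots_of_quarticCentre_simpleCMSurface hAs φA hE4 h11 h22 h12 h12' h1 h1' h2 hdim hreal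
    hK4 hCs hNA (avSlots_self A) (avSlots_self C)

end ProductSpan

end ProductSpanOpens

/-! ### §3 Condition (D): `B = D` on every power of `Y × S`, and the Hodge conjecture there — unconditionally -/

section ConditionD

variable {A C : AbelianVariety ℂ}

/-- **`Y` is stably nondegenerate**: `B•(Y^{N+1}) = D•(Y^{N+1}) ⊗ ℂ` for every `N` — R10's UNCONDITIONAL
`AbelianVariety.isDivisorGenerated_powSucc_of_quarticCM` (Moonen–Zarhin Thm. (0.2)(4) for simple type IV(2,1) with quartic
field, signature `{(2,0),(1,1)}`), packaged as `IsStablyNondegenerate`. [cite: MoonenZarhin1999LowDim, Thm. (0.2)(4) and §2 (2.4)]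
[cite: Gordon1999HodgeAVSurvey, Def. 7.6] -/
theorem AbelianVariety.isStablyNondegenerate_of_quarticCM (A : AbelianVariety ℂ) (hAs : A.IsSimple) (φA : A ⟶ A)
    (hE4 : Module.finrank ℚ A.endAlgebra = 4) {μ₁ μ₂ : ℂ} (h11 : starRingEnd ℂ μ₁ ≠ μ₁) (h22 : starRingEnd ℂ μ₂ ≠ μ₂)
    (h12 : μ₂ ≠ μ₁) (h12' : μ₂ ≠ starRingEnd ℂ μ₁) (h1 : eigenMultiplicity A φA μ₁ = 1)
    (h1' : eigenMultiplicity A φA (starRingEnd ℂ μ₁) = 1) (h2 : eigenMultiplicity A φA μ₂ = 2) (hdim : A.dim = 4) :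
    IsStablyNondegenerate A := fun N =>
  AbelianVariety.isDivisorGenerated_powSucc_of_quarticCM A hAs φA hE4 h11 h22 h12 h12' h1 h1' h2 hdim N

/-- **Condition (D) for `Y × S`, NON-ALIGNED**: `Y` stably nondegenerate (above), a simple abelian surface is (D)
(`AbelianVariety.isStablyNondegenerate_of_isSimple_surface`), product span on all equal powers (§2) ⟹ `Y × S` is stably
nondegenerate: **`B•((Y × S)ⁿ) = D•((Y × S)ⁿ)` for all `n ≥ 1`** (Moonen–Zarhin Thm. (3.2) with «`Hg(X) = Hg(Y₁) × Hg(Y₂)`»).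
[cite: MoonenZarhin1999LowDim, §3 Thm. (3.2), Lemma (3.6) and §5 Case 2] [cite: Gordon1999HodgeAVSurvey, Def. 7.6] -/
theorem isStablyNondegenerate_quarticCentre_prod_simpleCMSurface
    (hAs : A.IsSimple) (φA : A ⟶ A) (hE4 : Module.finrank ℚ A.endAlgebra = 4) {μ₁ μ₂ : ℂ}
    (h11 : starRingEnd ℂ μ₁ ≠ μ₁) (h22 : starRingEnd ℂ μ₂ ≠ μ₂) (h12 : μ₂ ≠ μ₁) (h12' : μ₂ ≠ starRingEnd ℂ μ₁)
    (h1 : eigenMultiplicity A φA μ₁ = 1) (h1' : eigenMultiplicity A φA (starRingEnd ℂ μ₁) = 1)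
    (h2 : eigenMultiplicity A φA μ₂ = 2) (hdim : A.dim = 4)
    {K : Type} [Field K] [NumberField K] [IsCMField K] {Φ : CMType K} {ιC : 𝓞 K →+* End C}
    {θ : K →+* Module.End ℂ (complexBetti C.X 1)} (hreal : IsCMTypeRealisation Φ C ιC θ)
    (hK4 : Module.finrank ℚ K = 4) (hCs : C.IsSimple)
    (hNA : ∀ w : ℂ, w ∈ IntermediateField.adjoin ℚ {μ₂} → w ∈ traceField Φ → starRingEnd ℂ w = -w → w = 0) :
    IsStablyNondegenerate (A.prod C) := by
  have hC2 : C.dim = 2 := by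
    have h := finrank_eq_two_mul_dim_of_isCMTypeRealisation hreal
    omega
  exact isStablyNondegenerate_prod_of_forall_productSpan_powSucc A C
    (fun N => hodgeClassesProductSpan_powSucc_powSucc_of_quarticCentre_simpleCMSurface hAs φA hE4 h11 h22 h12 h12' h1 h1'
      h2 hdim hreal hK4 hCs hNA N)
    (AbelianVariety.isStablyNondegenerate_of_quarticCM A hAs φA hE4 h11 h22 h12 h12' h1 h1' h2 hdim)
    (AbelianVariety.isStablyNondegenerate_of_isSimple_surface C hCs hC2)

/-- The order `S × Y`. [cite: MoonenZarhin1999LowDim, §3 Thm. (3.2)] -/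
theorem isStablyNondegenerate_simpleCMSurface_prod_quarticCentre
    (hAs : A.IsSimple) (φA : A ⟶ A) (hE4 : Module.finrank ℚ A.endAlgebra = 4) {μ₁ μ₂ : ℂ}
    (h11 : starRingEnd ℂ μ₁ ≠ μ₁) (h22 : starRingEnd ℂ μ₂ ≠ μ₂) (h12 : μ₂ ≠ μ₁) (h12' : μ₂ ≠ starRingEnd ℂ μ₁)
    (h1 : eigenMultiplicity A φA μ₁ = 1) (h1' : eigenMultiplicity A φA (starRingEnd ℂ μ₁) = 1)
    (h2 : eigenMultiplicity A φA μ₂ = 2) (hdim : A.dim = 4)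
    {K : Type} [Field K] [NumberField K] [IsCMField K] {Φ : CMType K} {ιC : 𝓞 K →+* End C}
    {θ : K →+* Module.End ℂ (complexBetti C.X 1)} (hreal : IsCMTypeRealisation Φ C ιC θ)
    (hK4 : Module.finrank ℚ K = 4) (hCs : C.IsSimple)
    (hNA : ∀ w : ℂ, w ∈ IntermediateField.adjoin ℚ {μ₂} → w ∈ traceField Φ → starRingEnd ℂ w = -w → w = 0) :
    IsStablyNondegenerate (C.prod A) :=
  (isStablyNondegenerate_quarticCentre_prod_simpleCMSurface hAs φA hE4 h11 h22 h12 h12' h1 h1' h2 hdim hreal hK4 hCs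
    hNA).of_isIsogenous (isIsogenous_prod_swap C A)

/-- **`B = D` on every power `(S × Y)^{N+1}` of a non-aligned pair** — UNCONDITIONAL. [cite: MoonenZarhin1999LowDim, §3 Thm. (3.2)] -/
theorem isDivisorGenerated_powSucc_simpleCMSurface_prod_quarticCentre
    (hAs : A.IsSimple) (φA : A ⟶ A) (hE4 : Module.finrank ℚ A.endAlgebra = 4) {μ₁ μ₂ : ℂ}
    (h11 : starRingEnd ℂ μ₁ ≠ μ₁) (h22 : starRingEnd ℂ μ₂ ≠ μ₂) (h12 : μ₂ ≠ μ₁) (h12' : μ₂ ≠ starRingEnd ℂ μ₁)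
    (h1 : eigenMultiplicity A φA μ₁ = 1) (h1' : eigenMultiplicity A φA (starRingEnd ℂ μ₁) = 1)
    (h2 : eigenMultiplicity A φA μ₂ = 2) (hdim : A.dim = 4)
    {K : Type} [Field K] [NumberField K] [IsCMField K] {Φ : CMType K} {ιC : 𝓞 K →+* End C}
    {θ : K →+* Module.End ℂ (complexBetti C.X 1)} (hreal : IsCMTypeRealisation Φ C ιC θ)
    (hK4 : Module.finrank ℚ K = 4) (hCs : C.IsSimple)
    (hNA : ∀ w : ℂ, w ∈ IntermediateField.adjoin ℚ {μ₂} → w ∈ traceField Φ → starRingEnd ℂ w = -w → w = 0)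
    (N : ℕ) : IsDivisorGenerated ((C.prod A).powSucc N) :=
  isStablyNondegenerate_simpleCMSurface_prod_quarticCentre hAs φA hE4 h11 h22 h12 h12' h1 h1' h2 hdim hreal hK4 hCs hNA N

/-- **The Hodge conjecture for every power `(S × Y)^{N+1}` of a non-aligned pair — UNCONDITIONALLY** (no HC_CM; `B = D` and
Lefschetz `(1,1)`). [cite: MoonenZarhin1999LowDim, §3 Thm. (3.2) and §5 Case 2] [cite: vanGeemen1994HodgeAV, §2.4 and Lemma 3.7] -/
theorem hodgeConjectureFor_powSucc_simpleCMSurface_prod_quarticCentre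
    (hAs : A.IsSimple) (φA : A ⟶ A) (hE4 : Module.finrank ℚ A.endAlgebra = 4) {μ₁ μ₂ : ℂ}
    (h11 : starRingEnd ℂ μ₁ ≠ μ₁) (h22 : starRingEnd ℂ μ₂ ≠ μ₂) (h12 : μ₂ ≠ μ₁) (h12' : μ₂ ≠ starRingEnd ℂ μ₁)
    (h1 : eigenMultiplicity A φA μ₁ = 1) (h1' : eigenMultiplicity A φA (starRingEnd ℂ μ₁) = 1)
    (h2 : eigenMultiplicity A φA μ₂ = 2) (hdim : A.dim = 4)
    {K : Type} [Field K] [NumberField K] [IsCMField K] {Φ : CMType K} {ιC : 𝓞 K →+* End C}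
    {θ : K →+* Module.End ℂ (complexBetti C.X 1)} (hreal : IsCMTypeRealisation Φ C ιC θ)
    (hK4 : Module.finrank ℚ K = 4) (hCs : C.IsSimple)
    (hNA : ∀ w : ℂ, w ∈ IntermediateField.adjoin ℚ {μ₂} → w ∈ traceField Φ → starRingEnd ℂ w = -w → w = 0)
    (N : ℕ) : HodgeConjectureFor ((C.prod A).powSucc N).dim ((C.prod A).powSucc N).X :=
  (isStablyNondegenerate_simpleCMSurface_prod_quarticCentre hAs φA hE4 h11 h22 h12 h12' h1 h1' h2 hdim hreal hK4 hCs
    hNA).hodgeConjectureFor_powSucc N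

/-- **The Hodge conjecture for the abelian SIXFOLD `S × Y` of a non-aligned pair itself.** [cite: MoonenZarhin1999LowDim, §3 Thm. (3.2)] -/
theorem hodgeConjectureFor_simpleCMSurface_prod_quarticCentre
    (hAs : A.IsSimple) (φA : A ⟶ A) (hE4 : Module.finrank ℚ A.endAlgebra = 4) {μ₁ μ₂ : ℂ}
    (h11 : starRingEnd ℂ μ₁ ≠ μ₁) (h22 : starRingEnd ℂ μ₂ ≠ μ₂) (h12 : μ₂ ≠ μ₁) (h12' : μ₂ ≠ starRingEnd ℂ μ₁)
    (h1 : eigenMultiplicity A φA μ₁ = 1) (h1' : eigenMultiplicity A φA (starRingEnd ℂ μ₁) = 1)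
    (h2 : eigenMultiplicity A φA μ₂ = 2) (hdim : A.dim = 4)
    {K : Type} [Field K] [NumberField K] [IsCMField K] {Φ : CMType K} {ιC : 𝓞 K →+* End C}
    {θ : K →+* Module.End ℂ (complexBetti C.X 1)} (hreal : IsCMTypeRealisation Φ C ιC θ)
    (hK4 : Module.finrank ℚ K = 4) (hCs : C.IsSimple)
    (hNA : ∀ w : ℂ, w ∈ IntermediateField.adjoin ℚ {μ₂} → w ∈ traceField Φ → starRingEnd ℂ w = -w → w = 0) :
    HodgeConjectureFor (C.prod A).dim (C.prod A).X :=
  (isStablyNondegenerate_simpleCMSurface_prod_quarticCentre hAs φA hE4 h11 h22 h12 h12' h1 h1' h2 hdim hreal hK4 hCs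
    hNA).hodgeConjectureFor

/-- **Everything isogenous to a power of `S × Y`** (van Geemen Lemma 3.7) satisfies the Hodge conjecture — every member of the
isogeny class of a non-aligned TABLE-X-row-25 sixfold, UNCONDITIONALLY. [cite: MoonenZarhin1999LowDim, §3 Thm. (3.2) and §5 Case 2]
[cite: vanGeemen1994HodgeAV, Lemma 3.7 and §3.6] -/
theorem hodgeConjectureFor_of_isIsogenous_powSucc_simpleCMSurface_prod_quarticCentre
    (hAs : A.IsSimple) (φA : A ⟶ A) (hE4 : Module.finrank ℚ A.endAlgebra = 4) {μ₁ μ₂ : ℂ}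
    (h11 : starRingEnd ℂ μ₁ ≠ μ₁) (h22 : starRingEnd ℂ μ₂ ≠ μ₂) (h12 : μ₂ ≠ μ₁) (h12' : μ₂ ≠ starRingEnd ℂ μ₁)
    (h1 : eigenMultiplicity A φA μ₁ = 1) (h1' : eigenMultiplicity A φA (starRingEnd ℂ μ₁) = 1)
    (h2 : eigenMultiplicity A φA μ₂ = 2) (hdim : A.dim = 4)
    {K : Type} [Field K] [NumberField K] [IsCMField K] {Φ : CMType K} {ιC : 𝓞 K →+* End C}
    {θ : K →+* Module.End ℂ (complexBetti C.X 1)} (hreal : IsCMTypeRealisation Φ C ιC θ)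
    (hK4 : Module.finrank ℚ K = 4) (hCs : C.IsSimple)
    (hNA : ∀ w : ℂ, w ∈ IntermediateField.adjoin ℚ {μ₂} → w ∈ traceField Φ → starRingEnd ℂ w = -w → w = 0)
    {X : AbelianVariety ℂ} {N : ℕ} (hX : AbelianVariety.IsIsogenous X ((C.prod A).powSucc N)) :
    HodgeConjectureFor X.dim X.X :=
  (isStablyNondegenerate_simpleCMSurface_prod_quarticCentre hAs φA hE4 h11 h22 h12 h12' h1 h1' h2 hdim hreal hK4 hCs
    hNA).hodgeConjectureFor_of_isIsogenous_powSucc hX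

/- **On path**: the Hodge conjecture gives every target of this file — the tree's
`hodgeConjectureFor_prod_of_hodgeConjecture'` (`ThetaTraceTimesCMProductSpan`), not re-declared (gate dedup). -/
example (h : ∀ ⦃n : ℕ⦄ ⦃X : Motives.SchemeOver ℂ⦄, Motives.IsSmoothProjective n X → HodgeConjectureFor n X)
    (S Y : AbelianVariety ℂ) : HodgeConjectureFor (S.prod Y).dim (S.prod Y).X :=
  hodgeConjectureFor_prod_of_hodgeConjecture' h S Y

end ConditionD

end Literature.AlgebraicGeometry.HodgeTheory

end
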